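/-
Copyright (c) 2026. All rights reserved.
Released under Apache 2.0 license as described in the file LICENSE.
-/
import Literature.AlgebraicGeometry.ComplexMultiplication.HyperellipticJacobianTwiceOddLevel
import Literature.AlgebraicGeometry.ComplexMultiplication.CyclotomicFermatCMTypesFixedFieldOfStabilizer
import HarnessLib

/-!
# GGL 2024 Lemma 12 for `4 ∣ m` (Gannon 1996, Lemma 5): the stabiliser of the lower-half type of `ℚ(ζ_m)` is
# EXACTLY `{1, m/2 − 1}` unless `m ∈ {20, 24, 60}`, where it is `{1,3,7,9}`, `{1,5,7,11}`, `{1,11,19,29}`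

Layer `Literature/AlgebraicGeometry/ComplexMultiplication`, namespace `…ComplexMultiplication.HyperellipticJacobian`; the sequel of
`HyperellipticJacobianTwiceOddLevel` (levels `m ≡ 2 (mod 4)`: the lower-half type `Φ_m = {σ : 2⟨e(σ)⟩ < m}` of `ℚ(ζ_m)` — the CM
type of the new part `X_m` of `J_m = Jac(y² = x^m + 1)`, GGL Lemma 11 — is primitive, `X_m ∼ X_{m/2}` simple), of
`HyperellipticJacobianExceptionalClasses` (odd levels: `Φ_m` primitive, Goodson Lemma 4.3) and of
`HyperellipticJacobianTwoPowerNondegenerate` §7–§9 (`m = 2^j ≥ 8`: the stabiliser of `Φ_m` is EXACTLY `{1, 2^{j−1} − 1}`, `Φ_m` is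
induced from a primitive type of index `2`).  THIS FILE completes GGL's LEMMA 12 at the levels `4 ∣ m`: the stabiliser of the lower
half `H_m = {c ∈ (ℤ/m)ˣ : ⟨c⟩ < m/2}` under unit multiplication is EXACTLY `{1, m/2 − 1}` for `m ∉ {20, 24, 60}` and the three
printed order-`4` groups there — the result GGL take from Gannon 1996 (Lemma 5) — and draws Thm. 3.0 (5)–(6) on the tree's carriers:
`Φ_m` is NOT primitive, NO realisation of `(ℚ(ζ_m); Φ_m)` is simple, every pattern class (Shimura's `H'/H₁`) has `2` (resp. `4`)
elements, `Φ_m` is induced from a PRIMITIVE type on a subfield `K₁` of index `2` (resp. `4`), **`K₁ = ℚ(ζ_m − ζ_m^{−1})`, the fixed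
field of `ζ ↦ −ζ̄`** (§7), and every realisation is isogenous to the SQUARE (resp. the FOURTH POWER at `20, 24, 60`) of a SIMPLE abelian
variety with complex multiplication by `K₁` (Shimura §6.2 Thm. 3, Koblitz–Rohrlich p. 1184).  THEOREMS ONLY (no definition, no named
fact, no `sorry`, no instance; kernel `decide` only at the levels `20, 24, 60`).

## The print

* A. Gallese, H. Goodson, D. Lombardo, *Monodromy groups and exceptional Hodge classes, I: Fermat Jacobians*, arXiv:2405.20394
  [GalleseGoodsonLombardo2024] (held `paper:arxiv-2405.20394`, p0012–p0013 read first-hand).  §3 THEOREM 3.0: «(5) if `d = 4k` with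
  `d ≠ 20, 24, 60`, then `X_d ∼ Y_d²` is isogenous to the square of a simple abelian variety `Y_d` with complex multiplication by
  `ℚ(ζ_d − ζ_d^{−1})` … (6) if `d = 20, 24, 60`, then `X_d ∼ Y_d⁴` is isogenous over `ℚ̄` to the 4th power of a simple abelian variety
  `Y_d`»; §3.2 LEMMA 12: «Let `m` be a positive integer and let `Φ_m` be the CM-type of Lemma 11.  The stabilizer of `Φ_m` for the
  `(ℤ/mℤ)ˣ`-action given by left multiplication on itself is: trivial, if `m` is odd or `m = 4k+2`; `{1, m/2 − 1}`, if `4 ∣ m` and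
  `m ≠ 20, 24, 60`; `{1,3,7,9}`, if `m = 20`; `{1,5,7,11}`, if `m = 24`; `{1,11,19,29}`, if `m = 60`», proof: «The cases where `m` is even
  follow from the slightly more general [Gannon1996]»; §3.3: «When `m` is a multiple of `4`, the abelian variety `X_m` is not
  geometrically irreducible. In the non-exceptional cases … `X_m` is geometrically isogenous to the square of some geometrically
  irreducible variety `Y_m`.  The CM-field of `Y_m` is the subfield of `ℚ(ζ_m)` fixed by `{1, m/2 − 1}` … which is `ℚ(ζ_m − ζ_m^{−1})`».
* T. Gannon, *The classification of SU(3) modular invariants revisited*, Ann. Inst. H. Poincaré Phys. Théor. **65** (1996) 15–55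
  [Gannon1996SU3Revisited] (held `paper:arxiv-hep-th_9404185`, p0005–p0007 read first-hand).  §2, (2.8): `R_m` = the integers
  `0 < a < m` with «`0 < {ℓ}_{2m} < m` and `ℓ ∈ C_{2m}` ⟹ `{ℓa}_{2m} < m`; `m < {ℓ}_{2m} < 2m` and `ℓ ∈ C_{2m}` ⟹ `{ℓa}_{2m} > m`»
  (`C_L` = the integers prime to `L`); LEMMA 5: «(a) for `m ≠ 6, 10, 12, 30`, we have `R_m = {1, m−1}`; (b) `R_6 = {1,3,5}`;
  `R_10 = {1,3,7,9}`; `R_12 = {1,5,7,11}`; `R_30 = {1,11,19,29}`» — GGL's level is `2m`, and on UNITS `a` the first line of (2.8) is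
  `a·H_{2m} = H_{2m}`.  Proof (pp. 5–7): «`a ∈ R_m` iff `m − a ∈ R_m`»; binary digits `b = a/m = 0.b₁b₂b₃…`; Case 1 (`m` odd, `ℓ = m − 2ʲ`);
  «Putting `ℓ = m − 1` forces `a ∈ R_m` to be odd»; `m = 2^L m'`, `c = {a/2^L}_2`; Case 2 (`c < 1`) and Case 3 (`c > 1`) with the units
  `ℓ_i = m' + 2ⁱ`, `ℓ'_j = m' − 2ʲ`, eqs. (2.10)–(2.11d), subcases (i)–(v), (v) = `L = 1`: «`a = m/3 + ε`», «Taking `ℓ = 3` … eliminates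
  `m ≡ −1 (mod 3)`», «take `ℓ = m/2 + 6`», «`ℓ = 4 + m/6`», «`ℓ = 2 + m/6`», «`ℓ = 6 + m/6` … for `m > 36` (`m ≠ 30`)», «There were some
  special values of `m` that slipped through these arguments: namely `m = 6, 10, 12, 14, 20, 28, 30`. These can be worked out explicitly.»
* G. Shimura, *Abelian Varieties with Complex Multiplication and Modular Functions* (1998) [Shimura1998] §8.2 Prop. 26 (`H₁ = H'`
  iff primitive; the tree's `isPrimitive_iff_hasTrivialStabilizer`, `not_isSimple_of_isCMTypeRealisation_of_not_isPrimitive`,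
  `exists_primitive_inducedCMType_finrank_eq`), §6.2 Thm. 3 (the tree's `Shimura1998_Thm3_isogenousPower_holds`), §8.4 Example (1).

## The proof typed here (unit form of Gannon's Lemma 5 at the levels `4 ∣ m`; the non-unit members of `R_m` are not treated)

Write `m = 2h`, `h = 2^L m'`, `m'` odd, `L ≥ 1`, and let the unit `t < m` stabilise `H_m`.  (§3, this file's shortcut replacing Gannon's
Cases 2 and 3 (i)–(iv)) The units `x₀ + 2m'j`, `j < 2^L`, lie in `H_m` iff `j < 2^{L−1}`, and `t(x₀ + 2m'j) ≡ y + 2m'(k + tj)` with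
`tx₀ = y + 2m'k`; so `j ↦ k + tj` preserves the first half of `ℤ/2^L`, which (§2, the ARC LEMMA: the progression `k, k + t, …` first
leaves `[0, 2^{L−1})` inside the second half) forces `t ≡ ±1 (mod 2^L)` and — at `x₀ = 1` — `t < 2m'` or `t ≥ h − 2m'`; after the
symmetry `t ↦ (h−1)t ≡ h − t` (§4) we are in the window `t < 2m'` with `2^L ∣ ⌊tx₀/2m'⌋` for every unit `x₀ < 2m'`.  (§1, Gannon's
argument at `L = 1`, i.e. his Case 3 (v) and the digit relations (2.10)–(2.11b)) With `B_i = ⌊2ⁱt/m'⌋` the test units `2ⁱ + m'` and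
`m' − 2ⁱ` give `⌊(B_i + t)/2⌋`, `⌊(t − 1 − B_i)/2⌋` even; for `t ≡ 1 (mod 4)` all digits vanish and `t = 1`; for `t ≡ 3 (mod 4)` the
digits alternate, `|3t − 2m'| < 4`, and the candidates die under `x = 3`, `m' + 6`, `m'/3 + 4`, `m'/3 + 2`, `m'/3 + 6` except
`(m', t) = (5, 3), (15, 11)` — the levels `20` and `60`; the survivor `t = 2m' − 1` dies for `L ≥ 2` (test `x₀ ≡ 3 (mod 4)`) except at
`(L, m') = (2, 3)` — the level `24`.  The three exceptional stabilisers themselves are finite checks (`decide`).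

## What is proved

* §1 (ℕ, level `4m'`): `div_two_pow_add`, `div_sub_two_pow` (the test units), `digit_constraints` ((2.10)–(2.11b)),
  `eq_one_of_mod_four_eq_one`, `eq_of_mod_four_eq_three`, `forall_div_even_reflect` («`a ∈ R_m` iff `m − a ∈ R_m`»),
  **`eq_or_of_forall_div_even`** — LEMMA 5 ON UNITS AT LEVEL `4m'`: `t ∈ {1, 2m' − 1}` or `(m', t) ∈ {(5, 3), (5, 7), (15, 11), (15, 19)}`.
* §2 (private) `mod_eq_one_or_of_forall_half_iff` (the arc lemma on `ℤ/N`, `N ≥ 4` even).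
* §3 (private) `forall_half_iff_coset` (the coset test), `window_of_stab`; **`eq_or_of_stab_of_lt`** (in the window: `t = 1`, or `L = 1` and a
  level-`4m'` exception, or `(L, m', t) = (2, 3, 5)`).
* §4 (`ℤ/m`): `val_mul_halfSubOne` (`⟨c(h−1)⟩ = h − ⟨c⟩` or `3h − ⟨c⟩`), `halfSubOne_mem_unitResidues`,
  **`two_mul_val_mul_halfSubOne_lt_iff`** (`m/2 − 1` stabilises `H_m`), **`eq_one_or_eq_halfSubOne_of_forall_iff`** and
  **`forall_iff_iff_eq_one_or_eq_halfSubOne`** — LEMMA 12 FOR `4 ∣ m ∉ {20, 24, 60}`: the stabiliser of `H_m` is EXACTLY `{1, m/2 − 1}`;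
  **`stabilizer_half_twenty`** `= {1,3,7,9}`, **`stabilizer_half_twentyFour`** `= {1,5,7,11}`, **`stabilizer_half_sixty`** `= {1,11,19,29}`.
* §5 (the type `Φ_m` of `K` with `IsCyclotomicExtension {m} ℚ K`, hypothesis `hΦ : σ ∈ Φ ↔ 2⟨e(σ)⟩ < m`): `mem_residueSet_half_iff`,
  **`forall_mem_residueSet_half_iff_eq_one_or`** (a unit stabilises `S_Φ` iff it is `1` or `m/2 − 1`: Shimura's `H' = {1, σ_{m/2−1}}`),
  **`not_hasTrivialStabilizer_half`**, **`not_isPrimitive_half`**, **`not_isSimple_of_four_dvd`** (`4 ∣ m`, `m ≥ 8`: NO realisation of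
  `Φ_m` is simple — «`X_m` is not geometrically irreducible»), `ncard_setOf_pattern_eq_card_stabilizer` (any type: a pattern class is a
  coset of the stabiliser), **`ncard_setOf_pattern_half_eq_two`**, `…_twenty ∕ _twentyFour ∕ _sixty` (`= 4`),
  **`exists_primitive_inducedCMType_index_two_of_four_dvd`** (THM. 3.0 (5) on types: `Φ_m` is induced from a primitive type on a subfield
  of index `2`).
* §6 (abelian varieties): `exists_isogeny_pow_simple_of_ncard` (Shimura Thm. 3 + Prop. 26 for a type with pattern classes of size `n`),
  **`exists_isogeny_pow_simple_of_four_dvd`** — THM. 3.0 (5): every realisation `A` (`dim A = φ(m)/2`) of `Φ_m`, `4 ∣ m ∉ {20,24,60}`,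
  `m ≥ 8`, is ISOGENOUS TO A POWER of a SIMPLE `B` with CM by the primitive subfield `K₁`, `[ℚ(ζ_m) : K₁] = 2`, `dim B = [K₁:ℚ]/2`;
  **`exists_isogeny_pow_simple_twenty`**, **`_twentyFour`** (`dim A = 4`, `B` a CM ELLIPTIC CURVE, `[ℚ(ζ) : K₁] = 4`),
  **`_sixty`** (`dim A = 8`, `B` a simple CM abelian SURFACE) — THM. 3.0 (6).
* §7 (Thm. 3.0 (5) ∕ §3.3 completed): `stabilizer_half_eq_pair`, `card_stabilizer_half_eq_two` (`W = {1, m/2 − 1}`, `|W| = 2`),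
  **`eq_fixedField_and_eq_adjoin_of_primitive_of_four_dvd`** — for ANY primitive sub-pair `(K₁, Φ₁)` of `Φ_m` (`4 ∣ m ≥ 8`,
  `m ∉ {20,24,60}`): `σ(ζ) = −ζ⁻¹`, `σ² = 1`, `K₁ = K^σ`, `ζ ∉ K₁`, `[K : K₁] = 2`, `2[K₁:ℚ] = φ(m)`, **`K₁ = ℚ(ζ_m − ζ_m^{−1})`**;
  **`exists_isogeny_sq_simple_of_four_dvd`** — `X_m ∼ Y_m × Y_m`: every realisation is `𝓞_{K₁}`-equivariantly isogenous to a product of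
  TWO copies of a SIMPLE `B ⊨ (K₁; Φ₁)`, `K₁ = ℚ(ζ_m − ζ_m^{−1})`, `4·dim B = φ(m)` (tree `exists_isIsogeny_power_simple_cyclotomic`, `|W| = 2`);
  **`exists_isogeny_pow_four_simple_twenty ∕ _twentyFour`** (`X ∼ Y⁴`, `Y` a simple CM elliptic curve), **`_sixty`** (`Y` a simple CM surface).
* §8 (§3.4 ∕ Lemma 14, the exceptional CM fields `F_{20}, F_{24}, F_{60}`): for ANY primitive sub-pair `(K₁, Φ₁)` of `Φ_{20}`, `Φ_{24}`,
  `Φ_{60}` the period `r = Σ_{h ∈ W} ζ^h` of the stabiliser lies in `K₁` and generates it: **`primitiveSubfield_twenty`** (`r = ζ + ζ³ + ζ⁷ + ζ⁹`,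
  `r² = −5`, `[K₁:ℚ] = 2`, `K₁ = ℚ(r) = ℚ(√−5)`), **`primitiveSubfield_twentyFour`** (`r = ζ + ζ⁵ + ζ⁷ + ζ¹¹`, `r² = −6`, `K₁ = ℚ(√−6)`),
  **`primitiveSubfield_sixty`** (`r = ζ + ζ¹¹ + ζ¹⁹ + ζ²⁹`, `r⁴ + 15r² + 45 = 0` via `2r² + 15 = 3s`, `s² = 5`, `[K₁:ℚ] = 4`, `K₁ = ℚ(r)`); the
  polynomial identities in `ℚ(ζ_m)` are certified by `linear_combination` over `ζ^{m/2} = −1` and the vanishing sums of the `5`-th ∕ `3`-rd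
  roots of unity, and `K₁ = ℚ(r)` by the quartic `Π_{h ∈ W}(X − ζ^h) ∈ ℚ(r)[X]` killing `ζ`.

## Honest column / NOT here

«over `ℚ`» ∕ «over `ℚ(ζ_d)`» ∕ «over `ℚ̄`» (fields of definition; §3.4's «no abelian variety in the isogeny class of `Y_d` can be defined over
`ℚ`», class numbers), the curve, `β`, `γ` and the eigen-subvarieties `X_m^±` of §3.3, Lemma 14's endomorphism ALGEBRAS (`Mat_{4×4}(F_m)`; here
only the CM fields `F_m`), the identification of `F_{60}` as a SPLITTING field (here: generated by one root), and the non-unit part of Gannon's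
`R_m` (his Lemma 5 is about all `0 < a < m`) are not typed (§6 keeps Shimura's existential exponent; §7 pins it); the proof of the unit
statement is this file's (2-adic reduction + Gannon's level-`4m'` digits), not Gannon's case tree; nothing here is an algebraicity
statement; `HC_CM` is not touched.

## References

* [GalleseGoodsonLombardo2024] A. Gallese, H. Goodson, D. Lombardo, arXiv:2405.20394 — §3 Thm. 3.0 (5)–(6), §3.1 Lemma 11, §3.2 Lemma 12,
  §3.3, §3.4 («ℚ(√−5) is the subfield of ℚ(ζ_{20}) fixed by {1,3,7,9}», «the CM field of `Y_{24}` is ℚ(√−6)», «`F_{60}` … a root of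
  `x⁴ + 15x² + 45`»), §3.5 Lemma 14 (the list `F_{20}, F_{24}, F_{60}`).
* [Gannon1996SU3Revisited] T. Gannon, Ann. Inst. H. Poincaré Phys. Théor. 65 (1996) 15–55, arXiv:hep-th/9404185 — §2 eq. (2.8),
  Lemma 5 and its proof (Cases 1–3, (2.9)–(2.11d), (i)–(v)).
* [Shimura1998] G. Shimura — §6.2 Thm. 3, §8.2 Prop. 26, §8.4 Example (1).
* [EmoryGoodson2026NondegeneracySatoTate] M. Emory, H. Goodson — §3.1 Prop. 3.2 (the 2-power precedent, tree
  `HyperellipticJacobianTwoPower.{eq_one_or_eq_of_forall_half_mul_iff, eq_fixedField_and_eq_adjoin_of_primitive}`).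
* [KoblitzRohrlich1978] N. Koblitz, D. Rohrlich, Canad. J. Math. 30 (1978) — §1 p. 1184 (fixed field of `W`, `|W|` simple factors;
  tree `CyclotomicFermatCMTypesFixedFieldOfStabilizer`, `exists_isIsogeny_power_simple_cyclotomic`).

## Provenance

Cell `pub-hodgecm2` (COR-CM), KEPT Literature lane `lit-deligne-3` gen 50 (claim GGL24-LEMMA12-FOUR-DVD; count-neutral, own lane).
-/

namespace Literature.AlgebraicGeometry.ComplexMultiplication

namespace HyperellipticJacobian

/-! ## §1 Arithmetic of the test units `2ⁱ + m'`, `m' − 2ⁱ` (Gannon's `ℓ_i = m' + 2ⁱ`, `ℓ'_j = m' − 2ʲ`) and the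
## level-`4m'` core: binary digits of `t/m'` -/

section Core

/-- Division of `n·m' + r` (`r < m'`) by `2m'` is division of `n` by `2`. [folklore] -/
private theorem add_mul_div_two_mul {n m' r : ℕ} (hm : 0 < m') (hr : r < m') :
    (n * m' + r) / (2 * m') = n / 2 := by
  have h2 : n = 2 * (n / 2) + n % 2 := (Nat.div_add_mod n 2).symm
  have hlt : (n % 2) * m' + r < 2 * m' := by
    have : n % 2 ≤ 1 := by omega
    nlinarith
  have h3 : n * m' + r = (n % 2) * m' + r + (2 * m') * (n / 2) := by
    nth_rw 1 [h2]
    ring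
  rw [h3, Nat.add_mul_div_left _ _ (by omega), Nat.div_eq_of_lt hlt, zero_add]

/-- Doubling a numerator doubles the quotient up to one: `2a / b ∈ {2(a/b), 2(a/b) + 1}`. [folklore] -/
private theorem two_mul_div_eq_or {a b : ℕ} (hb : 0 < b) :
    2 * a / b = 2 * (a / b) ∨ 2 * a / b = 2 * (a / b) + 1 := by
  have h := Nat.div_add_mod a b
  have hr := Nat.mod_lt a hb
  generalize a / b = q at *
  generalize a % b = r at *
  have h2a : 2 * a = 2 * r + b * (2 * q) := by rw [← h]; ring
  rcases Nat.lt_or_ge (2 * r) b with hlt | hge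
  · left
    rw [h2a, Nat.add_mul_div_left _ _ hb, Nat.div_eq_of_lt hlt, zero_add]
  · right
    have h2a' : 2 * a = (2 * r - b) + b * (2 * q + 1) := by rw [h2a]; zify [hge]; ring
    rw [h2a', Nat.add_mul_div_left _ _ hb, Nat.div_eq_of_lt (by omega), zero_add]

/-- **The test unit `x = 2ⁱ + m'`** (`ℓ_i = m' + 2ⁱ` of Gannon, read modulo `4m'`): `⌊t(2ⁱ + m')/2m'⌋ = ⌊(B_i + t)/2⌋` with
`B_i = ⌊2ⁱt/m'⌋`. [cite: Gannon1996SU3Revisited, §2 Lemma 5 (proof, eq. (2.10)–(2.11a))] -/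
theorem div_two_pow_add (m' t i : ℕ) (hm : 0 < m') :
    t * (2 ^ i + m') / (2 * m') = (2 ^ i * t / m' + t) / 2 := by
  have h := Nat.div_add_mod (2 ^ i * t) m'
  have hr := Nat.mod_lt (2 ^ i * t) hm
  generalize 2 ^ i * t / m' = B at *
  generalize 2 ^ i * t % m' = r at *
  have heq : t * (2 ^ i + m') = (B + t) * m' + r := by
    have : t * (2 ^ i + m') = 2 ^ i * t + t * m' := by ring
    rw [this, ← h]
    ring
  rw [heq, add_mul_div_two_mul hm hr]

/-- **The test unit `x = m' − 2ⁱ`** (`ℓ'_j = m' − 2ʲ`): `⌊t(m' − 2ⁱ)/2m'⌋ = ⌊(t − 1 − B_i)/2⌋` when `m' ∤ 2ⁱt` and `2ⁱ < m'`.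
[cite: Gannon1996SU3Revisited, §2 Lemma 5 (proof, eq. (2.11b))] -/
theorem div_sub_two_pow (m' t i : ℕ) (hi : 2 ^ i < m') (hndvd : ¬m' ∣ 2 ^ i * t) :
    t * (m' - 2 ^ i) / (2 * m') = (t - 1 - 2 ^ i * t / m') / 2 := by
  have hm : 0 < m' := lt_of_le_of_lt (Nat.zero_le _) hi
  have h := Nat.div_add_mod (2 ^ i * t) m'
  have hr := Nat.mod_lt (2 ^ i * t) hm
  have hr0 : 0 < 2 ^ i * t % m' := by
    rw [Nat.pos_iff_ne_zero]
    intro h0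
    exact hndvd (Nat.dvd_of_mod_eq_zero h0)
  have ht : 0 < t := by
    rw [Nat.pos_iff_ne_zero]
    rintro rfl
    exact hndvd ⟨0, by simp⟩
  have hBt : 2 ^ i * t / m' < t := by
    rw [Nat.div_lt_iff_lt_mul hm]
    calc 2 ^ i * t = t * 2 ^ i := mul_comm _ _
      _ < t * m' := Nat.mul_lt_mul_of_pos_left hi ht
  generalize 2 ^ i * t / m' = B at *
  generalize 2 ^ i * t % m' = r at *
  have h1 : 1 ≤ t := ht
  have h2 : B ≤ t - 1 := by omega
  have heq : t * (m' - 2 ^ i) = (t - 1 - B) * m' + (m' - r) := by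
    zify [hi.le, hr.le, h1, h2]
    have hz : ((2 ^ i * t : ℕ) : ℤ) = (m' : ℤ) * B + r := by exact_mod_cast h.symm
    push_cast at hz
    linear_combination -hz
  rw [heq, add_mul_div_two_mul hm (by omega)]

/-- `m' − 2ⁱ` is prime to `m'` for odd `m' > 2ⁱ`, `i ≥ 1`. [folklore] -/
private theorem coprime_sub_two_pow {m' i : ℕ} (hm : Odd m') (hi : 2 ^ i < m') : (m' - 2 ^ i).Coprime m' := by
  rw [Nat.coprime_self_sub_left hi.le]
  exact Nat.Coprime.pow_left i (Nat.coprime_two_left.2 hm)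

/-- `2ⁱ + m'` is prime to `m'` for odd `m'`. [folklore] -/
private theorem coprime_two_pow_add {m' i : ℕ} (hm : Odd m') : (2 ^ i + m').Coprime m' := by
  rw [Nat.coprime_add_self_left]
  exact Nat.Coprime.pow_left i (Nat.coprime_two_left.2 hm)

/-- `B_i = ⌊2ⁱt/m'⌋ < t` for `2ⁱ < m'`, `t > 0`. [folklore] -/
private theorem two_pow_mul_div_lt {m' t i : ℕ} (hi : 2 ^ i < m') (ht : 0 < t) : 2 ^ i * t / m' < t := by
  rw [Nat.div_lt_iff_lt_mul (lt_of_le_of_lt (Nat.zero_le _) hi)]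
  calc 2 ^ i * t = t * 2 ^ i := mul_comm _ _
    _ < t * m' := Nat.mul_lt_mul_of_pos_left hi ht

/-- **Gannon's constraints (2.11a–b) at level `4m'`, unit form.**  If `t < m'` (odd, prime to the odd `m'`) satisfies
`⌊tx/2m'⌋ ≡ 0 (mod 2)` for every odd `x < 2m'` prime to `m'`, then for `1 ≤ i`, `2ⁱ < m'`, with `B_i = ⌊2ⁱt/m'⌋` (the first `i`
binary digits of `t/m'`): `⌊(B_i + t)/2⌋` and `⌊(t − 1 − B_i)/2⌋` are both even (test units `2ⁱ + m'` and `m' − 2ⁱ`).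
[cite: Gannon1996SU3Revisited, §2 Lemma 5 (proof, eqs. (2.10), (2.11a), (2.11b))] -/
theorem digit_constraints {m' t : ℕ} (hm : Odd m') (htc : t.Coprime m') (htm : t < m')
    (hstab : ∀ x, x % 2 = 1 → x.Coprime m' → x < 2 * m' → t * x / (2 * m') % 2 = 0)
    {i : ℕ} (hi : 1 ≤ i) (him : 2 ^ i < m') :
    (2 ^ i * t / m' + t) / 2 % 2 = 0 ∧ (t - 1 - 2 ^ i * t / m') / 2 % 2 = 0 := by
  have hm0 : 0 < m' := by omega
  have hm1 : m' % 2 = 1 := Nat.odd_iff.1 hm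
  obtain ⟨j, rfl⟩ : ∃ j, i = j + 1 := ⟨i - 1, by omega⟩
  have hpow : 2 ^ (j + 1) = 2 * 2 ^ j := by rw [pow_succ, mul_comm]
  have h2j : 0 < 2 ^ j := Nat.two_pow_pos j
  have hndvd : ¬m' ∣ 2 ^ (j + 1) * t := by
    intro hd
    have hcop : (2 ^ (j + 1) * t).Coprime m' :=
      Nat.Coprime.mul_left (Nat.Coprime.pow_left _ (Nat.coprime_two_left.2 hm)) htc
    have := Nat.Coprime.eq_one_of_dvd hcop.symm hd
    omega
  constructor
  · have h := hstab (2 ^ (j + 1) + m') (by rw [hpow]; omega) (coprime_two_pow_add hm) (by omega)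
    rwa [div_two_pow_add m' t (j + 1) hm0] at h
  · have h := hstab (m' - 2 ^ (j + 1)) (by rw [hpow]; omega) (coprime_sub_two_pow hm him) (by omega)
    rwa [div_sub_two_pow m' t (j + 1) him hndvd] at h

/-- **Case `t ≡ 1 (mod 4)`: all digits vanish, `t = 1`** («`0 = b_1`, …»: `B_{i+1} ∈ {2B_i, 2B_i + 1}` and `⌊(B_{i+1} + t)/2⌋` even
force `B_{i+1} = 0`; at the top digit `2ᴵ < m' < 2ᴵ⁺¹` this gives `2ᴵt < m'`, `t < 2`).
[cite: Gannon1996SU3Revisited, §2 Lemma 5 (proof, Case 2)] -/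
theorem eq_one_of_mod_four_eq_one {m' t : ℕ} (hm : Odd m') (ht4 : t % 4 = 1) (htc : t.Coprime m') (htm : t < m')
    (hstab : ∀ x, x % 2 = 1 → x.Coprime m' → x < 2 * m' → t * x / (2 * m') % 2 = 0) : t = 1 := by
  have hm0 : 0 < m' := by omega
  -- all digits vanish
  have hdig : ∀ i, 2 ^ i < m' → 2 ^ i * t / m' = 0 := by
    intro i
    induction i with
    | zero => intro _; simpa using Nat.div_eq_of_lt htm
    | succ i ih =>
      intro hi1
      have hpow : 2 ^ (i + 1) = 2 * 2 ^ i := by rw [pow_succ, mul_comm]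
      have h2i : 0 < 2 ^ i := Nat.two_pow_pos i
      have hi0 : 2 ^ i < m' := lt_of_le_of_lt (by rw [hpow]; omega) hi1
      have hB := ih hi0
      have hstep := two_mul_div_eq_or (a := 2 ^ i * t) hm0
      rw [hB, mul_zero, zero_add, ← mul_assoc, ← hpow] at hstep
      have hC := (digit_constraints hm htc htm hstab (by omega) hi1).1
      omega
  -- the top digit
  set I := Nat.log 2 m' with hI
  have hle : 2 ^ I ≤ m' := Nat.pow_log_le_self 2 (by omega)
  have hlt : m' < 2 ^ (I + 1) := Nat.lt_pow_succ_log_self (by norm_num) m'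
  have hm1 : m' % 2 = 1 := Nat.odd_iff.1 hm
  have ht1 : 1 ≤ t := by omega
  have hI1 : 1 ≤ I := by
    by_contra h0
    have : I = 0 := by omega
    rw [this] at hlt
    norm_num at hlt
    omega
  have hne : 2 ^ I ≠ m' := by
    obtain ⟨J, hJ⟩ : ∃ J, I = J + 1 := ⟨I - 1, by omega⟩
    rw [hJ, pow_succ]
    have h2J : 0 < 2 ^ J := Nat.two_pow_pos J
    omega
  have hIlt : 2 ^ I < m' := lt_of_le_of_ne hle hne
  have h0 := hdig I hIlt
  rcases (Nat.div_eq_zero_iff).1 h0 with h | h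
  · omega
  · have h2 : 2 ^ I * t < 2 ^ I * 2 := by
      calc 2 ^ I * t < m' := h
        _ < 2 ^ (I + 1) := hlt
        _ = 2 ^ I * 2 := pow_succ 2 I
    have := Nat.lt_of_mul_lt_mul_left h2
    omega

/-- A test unit `x` with `tx = R + 2m'·Q`, `R < 2m'`, `Q` odd, violates the stabiliser condition. [folklore] -/
private theorem kill {m' t : ℕ} (hstab : ∀ x, x % 2 = 1 → x.Coprime m' → x < 2 * m' → t * x / (2 * m') % 2 = 0)
    {x Q R : ℕ} (hx1 : x % 2 = 1) (hxc : x.Coprime m') (hxlt : x < 2 * m') (hval : t * x = R + 2 * m' * Q)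
    (hR : R < 2 * m') (hQ : Q % 2 = 1) : False := by
  have h := hstab x hx1 hxc hxlt
  rw [hval, Nat.add_mul_div_left _ _ (by omega), Nat.div_eq_of_lt hR, zero_add] at h
  omega

/-- `c + k` is prime to `3k` when it is prime to `3` and `c` is prime to `k`. [folklore] -/
private theorem coprime_add_three_mul {c k : ℕ} (h3 : ¬3 ∣ c + k) (hc : c.Coprime k) : (c + k).Coprime (3 * k) :=
  Nat.Coprime.mul_right ((Nat.Prime.coprime_iff_not_dvd Nat.prime_three).2 h3).symm
    (Nat.coprime_add_self_left.2 hc)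

/-- `6` is prime to an odd number not divisible by `3`. [folklore] -/
private theorem coprime_six {k : ℕ} (hk : Odd k) (h3 : ¬3 ∣ k) : Nat.Coprime 6 k := by
  have h : Nat.Coprime (2 * 3) k :=
    Nat.Coprime.mul_left (Nat.coprime_two_left.2 hk) ((Nat.Prime.coprime_iff_not_dvd Nat.prime_three).2 h3)
  simpa using h

/-- **Case `t ≡ 3 (mod 4)`: the digits alternate, `|3t − 2m'| < 4`, and the candidates die except `(m', t) = (5, 3), (15, 11)`.**
The constraints force `B_i ≡ 1, 2 (mod 4)`, so `B_i = ⌊2^{i+1}/3⌋` («`b_1 ≠ b_2 ≠ ⋯`», Gannon's (2.11d) with `L = 1`, `c = 3/2`);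
at the top digit `3t − 2m' ∈ {±1, ±3}` («`a = m/3 + ε`»); `3t = 2m' + 1` dies by `x = 3`, `3t = 2m' − 1` by `x = m' + 6`
(`m' > 6`; «`ℓ = m/2 + 6`»), and for `3 ∣ m' = 3k`, `t = 2k ± 1`, by `x = k + 4, k + 2, k + 6` according to `k mod 6`
(«`ℓ = 4 + m/6`, `2 + m/6`, `6 + m/6`», the last for `k > 6`); `m' = 5` («`m = 10`») and `m' = 15` («`m = 30`») slip through.
[cite: Gannon1996SU3Revisited, §2 Lemma 5 (proof, Case 3 (v) and the list `m = 6, 10, 12, 14, 20, 28, 30`)] -/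
theorem eq_of_mod_four_eq_three {m' t : ℕ} (hm : Odd m') (ht4 : t % 4 = 3) (htc : t.Coprime m') (htm : t < m')
    (hstab : ∀ x, x % 2 = 1 → x.Coprime m' → x < 2 * m' → t * x / (2 * m') % 2 = 0) :
    (m' = 5 ∧ t = 3) ∨ (m' = 15 ∧ t = 11) := by
  have hm0 : 0 < m' := by omega
  have hm1 : m' % 2 = 1 := Nat.odd_iff.1 hm
  -- the digits alternate: `3·B_i ∈ {2^{i+1} − 2, 2^{i+1} − 1}`
  have hdig : ∀ i, 2 ^ i < m' → 2 ^ (i + 1) ≤ 3 * (2 ^ i * t / m') + 2 ∧ 3 * (2 ^ i * t / m') + 1 ≤ 2 ^ (i + 1) := by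
    intro i
    induction i with
    | zero => intro _; simp [Nat.div_eq_of_lt htm]
    | succ i ih =>
      intro hi1
      have hpow : 2 ^ (i + 1) = 2 * 2 ^ i := by rw [pow_succ, mul_comm]
      have hpow2 : 2 ^ (i + 1 + 1) = 2 * 2 ^ (i + 1) := by rw [pow_succ 2 (i + 1), mul_comm]
      have h2i : 0 < 2 ^ i := Nat.two_pow_pos i
      have hi0 : 2 ^ i < m' := lt_of_le_of_lt (by rw [hpow]; omega) hi1
      obtain ⟨h1, h2⟩ := ih hi0
      have hstep := two_mul_div_eq_or (a := 2 ^ i * t) hm0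
      rw [← mul_assoc, ← hpow] at hstep
      have hC := (digit_constraints hm htc htm hstab (by omega) hi1).1
      generalize 2 ^ (i + 1) * t / m' = B' at hstep hC ⊢
      rw [hpow2, hpow]
      rw [hpow] at h1 h2
      generalize 2 ^ i * t / m' = B at h1 h2 hstep
      generalize 2 ^ i = Q at h1 h2 ⊢
      omega
  -- the top digit `2^I < m' < 2^{I+1}`
  set I := Nat.log 2 m' with hI
  have hle : 2 ^ I ≤ m' := Nat.pow_log_le_self 2 (by omega)
  have hlt : m' < 2 ^ (I + 1) := Nat.lt_pow_succ_log_self (by norm_num) m'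
  have hI1 : 1 ≤ I := by
    by_contra h0
    have : I = 0 := by omega
    rw [this] at hlt
    norm_num at hlt
    omega
  have hne : 2 ^ I ≠ m' := by
    obtain ⟨J, hJ⟩ : ∃ J, I = J + 1 := ⟨I - 1, by omega⟩
    rw [hJ, pow_succ]
    have h2J : 0 < 2 ^ J := Nat.two_pow_pos J
    omega
  have hIlt : 2 ^ I < m' := lt_of_le_of_ne hle hne
  obtain ⟨h1, h2⟩ := hdig I hIlt
  have hBle : 2 ^ I * t / m' * m' ≤ 2 ^ I * t := Nat.div_mul_le_self _ _
  have hBlt : 2 ^ I * t < 2 ^ I * t / m' * m' + m' := Nat.lt_div_mul_add hm0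
  rw [pow_succ] at hlt h1 h2
  have hP0 : 0 < 2 ^ I := Nat.two_pow_pos I
  -- `|3t − 2m'| < 4`
  have h3t : 3 * t < 2 * m' + 4 ∧ 2 * m' < 3 * t + 4 := by
    generalize 2 ^ I * t / m' = B at h1 h2 hBle hBlt
    generalize hP : 2 ^ I = P at h1 h2 hBle hBlt hIlt hlt hP0
    have hm2 : (3 * B + 1) * m' ≤ (P * 2) * m' := Nat.mul_le_mul_right m' h2
    have hm1' : (P * 2) * m' ≤ (3 * B + 2) * m' := Nat.mul_le_mul_right m' h1
    constructor
    · refine Nat.lt_of_mul_lt_mul_left (a := P) ?_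
      nlinarith
    · refine Nat.lt_of_mul_lt_mul_left (a := P) ?_
      nlinarith
  have hρ : 3 * t = 2 * m' + 1 ∨ 3 * t + 1 = 2 * m' ∨ 3 * t = 2 * m' + 3 ∨ 3 * t + 3 = 2 * m' := by omega
  rcases hρ with hρ | hρ | hρ | hρ
  · -- `3t = 2m' + 1`: `x = 3`
    exfalso
    refine kill hstab (x := 3) (Q := 1) (R := 1) (by norm_num)
      ((Nat.Prime.coprime_iff_not_dvd Nat.prime_three).2 (by omega)) (by omega) (by omega) (by omega) (by norm_num)
  · -- `3t = 2m' − 1`: `m' = 5` or `x = m' + 6`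
    by_cases h5 : m' = 5
    · exact Or.inl ⟨h5, by omega⟩
    · exfalso
      obtain ⟨s, hs⟩ : ∃ s, m' = 6 * s + 11 := ⟨(m' - 11) / 6, by omega⟩
      have ht : t = 4 * s + 7 := by omega
      have h3 : ¬3 ∣ m' := by omega
      refine kill hstab (x := 6 + m') (Q := 2 * s + 5) (R := 6 * s + 9) (by omega)
        (Nat.coprime_add_self_left.2 (coprime_six hm h3)) (by omega) ?_ (by omega) (by omega)
      rw [ht, hs]; ring
  · -- `3t = 2m' + 3`: `m' = 3k`, `t = 2k + 1`
    obtain ⟨k, hk⟩ : ∃ k, m' = 3 * k := ⟨m' / 3, by omega⟩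
    have ht : t = 2 * k + 1 := by omega
    have ht3 : ¬3 ∣ t := by
      intro h3
      have := Nat.Coprime.coprime_dvd_right (Dvd.intro k hk.symm) htc
      rw [Nat.Coprime, Nat.gcd_eq_right h3] at this
      omega
    have hk6 : k % 6 = 3 ∨ k % 6 = 5 := by omega
    rcases hk6 with hk6 | hk6
    · exfalso
      obtain ⟨q, hq⟩ : ∃ q, k = 6 * q + 3 := ⟨k / 6, by omega⟩
      refine kill hstab (x := 2 + k) (Q := 2 * q + 1) (R := 30 * q + 17) (by omega)
        (hk ▸ coprime_add_three_mul (by omega) (Nat.coprime_two_left.2 (Nat.odd_iff.2 (by omega)))) (by omega) ?_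
        (by omega) (by omega)
      rw [ht, hk, hq]; ring
    · by_cases hk5 : k = 5
      · exact Or.inr ⟨by omega, by omega⟩
      · exfalso
        obtain ⟨q, hq⟩ : ∃ q, k = 6 * q + 11 := ⟨(k - 11) / 6, by omega⟩
        refine kill hstab (x := 6 + k) (Q := 2 * q + 5) (R := 30 * q + 61) (by omega)
          (hk ▸ coprime_add_three_mul (by omega) (coprime_six (Nat.odd_iff.2 (by omega)) (by omega))) (by omega) ?_
          (by omega) (by omega)
        rw [ht, hk, hq]; ring
  · -- `3t = 2m' − 3`: `m' = 3k`, `t = 2k − 1`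
    obtain ⟨k, hk⟩ : ∃ k, m' = 3 * k := ⟨m' / 3, by omega⟩
    have ht3 : ¬3 ∣ t := by
      intro h3
      have := Nat.Coprime.coprime_dvd_right (Dvd.intro k hk.symm) htc
      rw [Nat.Coprime, Nat.gcd_eq_right h3] at this
      omega
    have hk6 : k % 6 = 1 ∨ k % 6 = 3 := by omega
    exfalso
    rcases hk6 with hk6 | hk6
    · obtain ⟨q, hq⟩ : ∃ q, k = 6 * q + 7 := ⟨(k - 7) / 6, by omega⟩
      have ht : t = 12 * q + 13 := by omega
      have h4 : Nat.Coprime 4 k := by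
        have h : Nat.Coprime (2 ^ 2) k := Nat.Coprime.pow_left 2 (Nat.coprime_two_left.2 (Nat.odd_iff.2 (by omega)))
        simpa using h
      refine kill hstab (x := 4 + k) (Q := 2 * q + 3) (R := 18 * q + 17) (by omega)
        (hk ▸ coprime_add_three_mul (by omega) h4) (by omega) ?_ (by omega) (by omega)
      rw [ht, hk, hq]; ring
    · obtain ⟨q, hq⟩ : ∃ q, k = 6 * q + 3 := ⟨k / 6, by omega⟩
      have ht : t = 12 * q + 5 := by omega
      refine kill hstab (x := 2 + k) (Q := 2 * q + 1) (R := 18 * q + 7) (by omega)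
        (hk ▸ coprime_add_three_mul (by omega) (Nat.coprime_two_left.2 (Nat.odd_iff.2 (by omega)))) (by omega) ?_
        (by omega) (by omega)
      rw [ht, hk, hq]; ring

/-- **The reflection `t ↦ 2m' − t`** preserves the level-`4m'` stabiliser condition (`⌊(2m' − t)x/2m'⌋ = x − 1 − ⌊tx/2m'⌋`
for `2m' ∤ tx`; Gannon: «`a ∈ R_m` iff `m − a ∈ R_m`»). [cite: Gannon1996SU3Revisited, §2 Lemma 5 (proof, first paragraph)] -/
theorem forall_div_even_reflect {m' t : ℕ} (ht2 : t < 2 * m') (htc : t.Coprime (2 * m'))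
    (hstab : ∀ x, x % 2 = 1 → x.Coprime m' → x < 2 * m' → t * x / (2 * m') % 2 = 0) :
    ∀ x, x % 2 = 1 → x.Coprime m' → x < 2 * m' → (2 * m' - t) * x / (2 * m') % 2 = 0 := by
  intro x hx1 hxc hxlt
  have hm0 : 0 < 2 * m' := by omega
  have h := hstab x hx1 hxc hxlt
  have hdm := Nat.div_add_mod (t * x) (2 * m')
  have hx2 : x.Coprime (2 * m') := Nat.Coprime.mul_right (Nat.coprime_two_right.2 (Nat.odd_iff.2 hx1)) hxc
  have hr0 : 0 < t * x % (2 * m') := by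
    rw [Nat.pos_iff_ne_zero]
    intro h0
    have h1 := Nat.Coprime.eq_one_of_dvd (Nat.Coprime.mul_left htc hx2).symm (Nat.dvd_of_mod_eq_zero h0)
    omega
  have hqx : t * x / (2 * m') < x := by
    rw [Nat.div_lt_iff_lt_mul hm0, mul_comm x]
    exact Nat.mul_lt_mul_of_pos_right ht2 (show 0 < x by omega)
  have hr := Nat.mod_lt (t * x) hm0
  generalize t * x / (2 * m') = q at h hdm hqx
  generalize t * x % (2 * m') = r at hdm hr0 hr
  have heq : (2 * m' - t) * x = (2 * m' - r) + 2 * m' * (x - 1 - q) := by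
    zify [ht2.le, hr.le, show 1 ≤ x by omega, show q ≤ x - 1 by omega]
    have hz : ((t * x : ℕ) : ℤ) = 2 * m' * q + r := by exact_mod_cast hdm.symm
    push_cast at hz
    linear_combination -hz
  rw [heq, Nat.add_mul_div_left _ _ hm0, Nat.div_eq_of_lt (by omega), zero_add]
  omega

/-- **GANNON 1996 LEMMA 5 AT LEVEL `4m'`, UNIT FORM** (`m = 2m'` in Gannon's notation; GGL Lemma 12 for `m = 4m'`): if an odd
`t < 2m'` prime to the odd `m'` satisfies `⌊tx/2m'⌋ ≡ 0 (mod 2)` for every odd `x < 2m'` prime to `m'` — i.e. multiplication by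
`t` preserves the lower half of `(ℤ/4m')ˣ` — then `t ∈ {1, 2m' − 1}`, or `m' = 5`, `t ∈ {3, 7}` («`R_10 = {1,3,7,9}`»), or `m' = 15`,
`t ∈ {11, 19}` («`R_30 = {1,11,19,29}`»).  Proof: reflect to `t < m'`; `t ≡ 1 (mod 4)` ⟹ `t = 1` (`eq_one_of_mod_four_eq_one`);
`t ≡ 3 (mod 4)` ⟹ the exceptions (`eq_of_mod_four_eq_three`). [cite: Gannon1996SU3Revisited, §2 Lemma 5 (a), (b)]
[cite: GalleseGoodsonLombardo2024, §3.2 Lemma 12] -/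
theorem eq_or_of_forall_div_even {m' t : ℕ} (hm : Odd m') (htc : t.Coprime (2 * m')) (ht2 : t < 2 * m')
    (hstab : ∀ x, x % 2 = 1 → x.Coprime m' → x < 2 * m' → t * x / (2 * m') % 2 = 0) :
    t = 1 ∨ t = 2 * m' - 1 ∨ (m' = 5 ∧ (t = 3 ∨ t = 7)) ∨ (m' = 15 ∧ (t = 11 ∨ t = 19)) := by
  have hm1 : m' % 2 = 1 := Nat.odd_iff.1 hm
  have ht1 : t % 2 = 1 := by
    have h2 : t.Coprime 2 := htc.coprime_dvd_right (dvd_mul_right 2 m')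
    exact Nat.odd_iff.1 (Nat.coprime_two_right.1 h2)
  have htc' : t.Coprime m' := htc.coprime_dvd_right (dvd_mul_left m' 2)
  rcases Nat.lt_trichotomy t m' with hlt | heq | hgt
  · -- `t < m'`
    rcases (show t % 4 = 1 ∨ t % 4 = 3 by omega) with h4 | h4
    · exact Or.inl (eq_one_of_mod_four_eq_one hm h4 htc' hlt hstab)
    · rcases eq_of_mod_four_eq_three hm h4 htc' hlt hstab with ⟨h5, h3⟩ | ⟨h15, h11⟩
      · exact Or.inr (Or.inr (Or.inl ⟨h5, Or.inl h3⟩))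
      · exact Or.inr (Or.inr (Or.inr ⟨h15, Or.inl h11⟩))
  · -- `t = m'`: then `m' = t = 1`
    subst heq
    exact Or.inl (Nat.Coprime.eq_one_of_dvd htc' dvd_rfl)
  · -- `m' < t < 2m'`: reflect
    have hstab' := forall_div_even_reflect ht2 htc hstab
    have hlt' : 2 * m' - t < m' := by omega
    have htc2 : (2 * m' - t).Coprime m' :=
      ((Nat.coprime_self_sub_left ht2.le).2 htc).coprime_dvd_right (dvd_mul_left m' 2)
    rcases (show (2 * m' - t) % 4 = 1 ∨ (2 * m' - t) % 4 = 3 by omega) with h4 | h4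
    · have := eq_one_of_mod_four_eq_one hm h4 htc2 hlt' hstab'
      exact Or.inr (Or.inl (by omega))
    · rcases eq_of_mod_four_eq_three hm h4 htc2 hlt' hstab' with ⟨h5, h3⟩ | ⟨h15, h11⟩
      · exact Or.inr (Or.inr (Or.inl ⟨h5, Or.inr (by omega)⟩))
      · exact Or.inr (Or.inr (Or.inr ⟨h15, Or.inr (by omega)⟩))

end Core

/-! ## §2 The 2-adic reduction: an affine map `j ↦ k + tj` of `ℤ/2^L` preserving the first half is `±`identity -/

section Arc

/-- No affine map `j ↦ k + t₀j (mod N)` with `2 ≤ t₀ ≤ N/2` preserves the first half `[0, N/2)` of `ℤ/N` (`N ≥ 4` even,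
`k < N/2`): the progression `k, k + t₀, …` first leaves `[0, N/2)` inside `[N/2, N)`. [folklore] -/
private theorem not_forall_half_iff_of_two_le {N t₀ k : ℕ} (h4 : 4 ≤ N) (hk : k < N / 2) (h2 : 2 ≤ t₀)
    (h2t : 2 * t₀ ≤ N) (h : ∀ j < N, ((k + t₀ * j) % N < N / 2 ↔ j < N / 2)) : False := by
  have hex : ∃ j, N / 2 ≤ k + t₀ * j := by
    refine ⟨N / 2 - 1, ?_⟩
    have := Nat.mul_le_mul_right (N / 2 - 1) h2
    omega
  classical
  set j₁ := Nat.find hex with hj₁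
  have hspec : N / 2 ≤ k + t₀ * j₁ := Nat.find_spec hex
  have hle : j₁ ≤ N / 2 - 1 := Nat.find_min' hex (by
    have := Nat.mul_le_mul_right (N / 2 - 1) h2
    omega)
  have hpos : 0 < j₁ := by
    rw [Nat.pos_iff_ne_zero]
    intro h0
    rw [h0, mul_zero, add_zero] at hspec
    omega
  have hprev : ¬N / 2 ≤ k + t₀ * (j₁ - 1) := Nat.find_min hex (by omega)
  have hsplit : t₀ * j₁ = t₀ * (j₁ - 1) + t₀ := by
    obtain ⟨j, hj⟩ : ∃ j, j₁ = j + 1 := ⟨j₁ - 1, by omega⟩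
    rw [hj, Nat.add_sub_cancel, mul_add, mul_one]
  have hltN : k + t₀ * j₁ < N := by omega
  have hj := (h j₁ (by omega)).2 (by omega)
  rw [Nat.mod_eq_of_lt hltN] at hj
  omega

/-- **The arc lemma.**  If `j ↦ k + tj (mod N)` preserves the first half `[0, N/2)` of `ℤ/N` (`N ≥ 4` even, `k < N`), then
`t ≡ 1`, `k = 0` or `t ≡ −1`, `k = N/2 − 1` (for `2 ≤ t mod N ≤ N/2` the progression leaves the half; for `N/2 < t mod N ≤ N − 2`
compose with the reflection `x ↦ N/2 − 1 − x`). [folklore] -/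
private theorem mod_eq_one_or_of_forall_half_iff {N t k : ℕ} (hN : N % 2 = 0) (h4 : 4 ≤ N) (hk : k < N)
    (h : ∀ j < N, ((k + t * j) % N < N / 2 ↔ j < N / 2)) :
    (t % N = 1 ∧ k = 0) ∨ (t % N = N - 1 ∧ k + 1 = N / 2) := by
  have hN0 : 0 < N := by omega
  have hk2 : k < N / 2 := by
    have := (h 0 hN0).2 (by omega)
    rwa [mul_zero, add_zero, Nat.mod_eq_of_lt hk] at this
  have hmod : ∀ j, (k + t * j) % N = (k + t % N * j) % N := fun j =>
    (((Nat.mod_modEq t N).mul_right j).add_left k).symm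
  have h' : ∀ j < N, ((k + t % N * j) % N < N / 2 ↔ j < N / 2) := fun j hj => by rw [← hmod]; exact h j hj
  have ht : t % N < N := Nat.mod_lt t hN0
  generalize t % N = t₀ at h' ht ⊢
  by_cases h0 : t₀ = 0
  · exfalso
    have := (h' (N / 2) (by omega)).1 (by rw [h0, zero_mul, add_zero, Nat.mod_eq_of_lt hk]; exact hk2)
    omega
  by_cases h1 : t₀ = 1
  · refine Or.inl ⟨h1, ?_⟩
    by_contra hk0
    have := (h' (N / 2 - k) (by omega)).2 (by omega)
    rw [h1, one_mul, show k + (N / 2 - k) = N / 2 by omega, Nat.mod_eq_of_lt (by omega)] at this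
    omega
  by_cases hm1 : t₀ = N - 1
  · refine Or.inr ⟨hm1, ?_⟩
    by_contra hk1
    have := (h' (k + 1) (by omega)).2 (by omega)
    rw [hm1, show k + (N - 1) * (k + 1) = (N - 1) + N * k by
      zify [show 1 ≤ N by omega]; ring, Nat.add_mul_mod_self_left, Nat.mod_eq_of_lt (by omega)] at this
    omega
  exfalso
  rcases Nat.lt_or_ge (N / 2) t₀ with hbig | hsmall
  · -- reflect: `j ↦ (N/2 − 1 − k) + (N − t₀) j`
    refine not_forall_half_iff_of_two_le (t₀ := N - t₀) (k := N / 2 - 1 - k) h4 (by omega) (by omega) (by omega) ?_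
    intro j hj
    rw [← h' j hj]
    have hsum : (N / 2 - 1 - k + (N - t₀) * j) + (k + t₀ * j) = (N / 2 - 1) + N * j := by
      zify [ht.le, show 1 ≤ N / 2 by omega, show k ≤ N / 2 - 1 by omega]
      ring
    have hmodsum := congrArg (· % N) hsum
    simp only [Nat.add_mul_mod_self_left] at hmodsum
    rw [Nat.add_mod, Nat.mod_eq_of_lt (show N / 2 - 1 < N by omega)] at hmodsum
    have hu := Nat.mod_lt (N / 2 - 1 - k + (N - t₀) * j) hN0
    have hv := Nat.mod_lt (k + t₀ * j) hN0
    generalize (N / 2 - 1 - k + (N - t₀) * j) % N = u at hmodsum hu ⊢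
    generalize (k + t₀ * j) % N = v at hmodsum hv ⊢
    rcases Nat.lt_or_ge (u + v) N with hl | hg
    · rw [Nat.mod_eq_of_lt hl] at hmodsum
      omega
    · rw [Nat.mod_eq_sub_mod hg, Nat.mod_eq_of_lt (by omega)] at hmodsum
      omega
  · exact not_forall_half_iff_of_two_le h4 hk2 (by omega) (by omega) h'

end Arc

/-! ## §3 The cosets `x₀ + 2m'·j` of the units `≡ x₀ (mod 2m')`: a stabiliser of the lower half of `(ℤ/2^{L+1}m')ˣ` lies in
## the window `(0, 2m')` up to `t ↦ h − t`, and there it satisfies the level-`4m'` condition `2^L ∣ ⌊tx₀/2m'⌋` -/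

section Coset

/-- `y + 2m'·Z < N·m' ⟺ Z < N/2` for `y < 2m'`, `N` even. [folklore] -/
private theorem add_lt_half_iff {m' N y Z : ℕ} (hN : N % 2 = 0) (hy : y < 2 * m') :
    y + 2 * m' * Z < N * m' ↔ Z < N / 2 := by
  obtain ⟨M, rfl⟩ : ∃ M, N = 2 * M := ⟨N / 2, by omega⟩
  rw [show 2 * M / 2 = M by omega]
  constructor
  · intro h
    by_contra hZ
    have := Nat.mul_le_mul_left (2 * m') (show M ≤ Z by omega)
    nlinarith
  · intro h
    have := Nat.mul_le_mul_left (2 * m') (show Z + 1 ≤ M by omega)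
    nlinarith

/-- `(y + 2m'·Z) mod (2m'·N) = y + 2m'·(Z mod N)` for `y < 2m'`. [folklore] -/
private theorem add_mul_mod_mul {m' N y Z : ℕ} (hN : 0 < N) (hy : y < 2 * m') :
    (y + 2 * m' * Z) % (2 * m' * N) = y + 2 * m' * (Z % N) := by
  have hZ := Nat.div_add_mod Z N
  have hlt : y + 2 * m' * (Z % N) < 2 * m' * N := by
    have := Nat.mul_le_mul_left (2 * m') (show Z % N + 1 ≤ N from Nat.mod_lt Z hN)
    nlinarith
  have heq : y + 2 * m' * Z = y + 2 * m' * (Z % N) + (2 * m' * N) * (Z / N) := by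
    nth_rw 1 [← hZ]
    ring
  rw [heq, Nat.add_mul_mod_self_left, Nat.mod_eq_of_lt hlt]

variable {L m' m h t : ℕ}

/-- **The coset test.**  For a stabiliser `t` of the lower half `(0, h)` of the units modulo `m = 2h`, `h = 2^L m'`, and a unit
`x₀ < 2m'`: the units `x₀ + 2m'j` (`j < 2^L`) lie in the lower half iff `j < 2^{L−1}`, and `t(x₀ + 2m'j) ≡ y + 2m'(k + tj)` with
`tx₀ = y + 2m'k`, so `j ↦ k + tj (mod 2^L)` preserves the first half of `ℤ/2^L` (this file's 2-adic reduction). [folklore] -/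
private theorem forall_half_iff_coset (hL : 1 ≤ L) (hmdef : m = 2 * m' * 2 ^ L) (hhdef : h = 2 ^ L * m')
    (hstab : ∀ c, c.Coprime m → c < m → (t * c % m < h ↔ c < h)) {x₀ : ℕ} (hx : x₀.Coprime (2 * m'))
    (hx2 : x₀ < 2 * m') :
    ∀ j < 2 ^ L, ((t * x₀ / (2 * m') % 2 ^ L + t * j) % 2 ^ L < 2 ^ L / 2 ↔ j < 2 ^ L / 2) := by
  intro j hj
  subst hmdef hhdef
  obtain ⟨L', rfl⟩ : ∃ L', L = L' + 1 := ⟨L - 1, by omega⟩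
  set N := 2 ^ (L' + 1) with hN
  have hNeven : N % 2 = 0 := by rw [hN, pow_succ]; omega
  have hN0 : 0 < N := Nat.two_pow_pos _
  have hx1 : x₀ % 2 = 1 :=
    Nat.odd_iff.1 (Nat.coprime_two_right.1 (hx.coprime_dvd_right (dvd_mul_right 2 m')))
  -- the unit `c = x₀ + 2m'j`
  have hclt : x₀ + 2 * m' * j < 2 * m' * N := by
    have := Nat.mul_le_mul_left (2 * m') (show j + 1 ≤ N by omega)
    nlinarith
  have hcodd : (x₀ + 2 * m' * j) % 2 = 1 := by
    have : 2 * m' * j = 2 * (m' * j) := by ring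
    omega
  have hccop : (x₀ + 2 * m' * j).Coprime (2 * m' * N) := by
    refine Nat.Coprime.mul_right ((Nat.coprime_add_mul_left_left x₀ (2 * m') j).2 hx) ?_
    rw [hN]
    exact Nat.Coprime.pow_right _ (Nat.coprime_two_right.2 (Nat.odd_iff.2 hcodd))
  have hmem : x₀ + 2 * m' * j < N * m' ↔ j < N / 2 := add_lt_half_iff hNeven hx2
  -- `t·c ≡ y + 2m'·((k + tj) mod N)`
  have hy := Nat.mod_lt (t * x₀) (show 0 < 2 * m' by omega)
  have htc : t * (x₀ + 2 * m' * j) = t * x₀ % (2 * m') + 2 * m' * (t * x₀ / (2 * m') + t * j) := by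
    have hd := Nat.mod_add_div (t * x₀) (2 * m')
    generalize t * x₀ % (2 * m') = y at hd ⊢
    generalize t * x₀ / (2 * m') = k at hd ⊢
    rw [mul_add, ← hd]
    ring
  have hval : t * (x₀ + 2 * m' * j) % (2 * m' * N) < N * m' ↔ (t * x₀ / (2 * m') + t * j) % N < N / 2 := by
    rw [htc, add_mul_mod_mul hN0 hy, add_lt_half_iff hNeven hy]
  have key := hstab _ hccop hclt
  rw [show 2 ^ (L' + 1) * m' = N * m' from rfl] at key
  rw [hval, hmem, ← Nat.mod_add_mod] at key
  exact key

/-- **The window.**  A stabiliser `t < m` of the lower half (`m = 2h`, `h = 2^L m'`, `L ≥ 1`) lies below `h`, and either `t < 2m'`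
with `t ≡ 1 (mod 2^L)` (or `L = 1`), or `t ≥ h − 2m'` with `t ≡ −1 (mod 2^L)`, `L ≥ 2` (the coset test at `x₀ = 1` and the arc
lemma; this file's 2-adic reduction). [folklore] -/
private theorem window_of_stab (hL : 1 ≤ L) (hmdef : m = 2 * m' * 2 ^ L) (hhdef : h = 2 ^ L * m') (hm1 : 1 ≤ m')
    (hstab : ∀ c, c.Coprime m → c < m → (t * c % m < h ↔ c < h)) (htlt : t < m) :
    t < h ∧ ((t < 2 * m' ∧ (L = 1 ∨ t % 2 ^ L = 1)) ∨ (h ≤ t + 2 * m' ∧ t % 2 ^ L = 2 ^ L - 1 ∧ 2 ≤ L)) := by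
  have hcos := forall_half_iff_coset hL hmdef hhdef hstab (Nat.coprime_one_left _) (by omega)
  subst hmdef hhdef
  have hP : 2 ≤ 2 ^ L := by
    calc (2 : ℕ) = 2 ^ 1 := by norm_num
      _ ≤ 2 ^ L := Nat.pow_le_pow_right (by norm_num) hL
  have hth : t < 2 ^ L * m' := by
    have h1 := (hstab 1 (Nat.coprime_one_left _) (by nlinarith)).2 (by nlinarith)
    rwa [mul_one, Nat.mod_eq_of_lt htlt] at h1
  refine ⟨hth, ?_⟩
  have hNeven : 2 ^ L % 2 = 0 := by
    obtain ⟨L', rfl⟩ : ∃ L', L = L' + 1 := ⟨L - 1, by omega⟩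
    rw [pow_succ]; omega
  have hk : t / (2 * m') < 2 ^ L / 2 := by
    rw [Nat.div_lt_iff_lt_mul (by omega)]
    have : 2 ^ L / 2 * (2 * m') = 2 ^ L * m' := by
      have := Nat.div_add_mod (2 ^ L) 2
      rw [hNeven, add_zero] at this
      nth_rw 2 [← this]
      ring
    rwa [this]
  rw [mul_one, Nat.mod_eq_of_lt (show t / (2 * m') < 2 ^ L by omega)] at hcos
  rcases Nat.lt_or_ge L 2 with hL1 | hL2
  · left
    have hL1' : L = 1 := by omega
    subst hL1'
    exact ⟨by omega, Or.inl rfl⟩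
  · have h4 : 4 ≤ 2 ^ L := by
      calc (4 : ℕ) = 2 ^ 2 := by norm_num
        _ ≤ 2 ^ L := Nat.pow_le_pow_right (by norm_num) hL2
    rcases mod_eq_one_or_of_forall_half_iff hNeven h4 (by omega) hcos with ⟨ht1, hk0⟩ | ⟨htm, hkm⟩
    · left
      refine ⟨?_, Or.inr ht1⟩
      rcases (Nat.div_eq_zero_iff).1 hk0 with h0 | h0
      · omega
      · exact h0
    · right
      refine ⟨?_, htm, hL2⟩
      have hle : t / (2 * m') * (2 * m') ≤ t := Nat.div_mul_le_self _ _
      have : (2 ^ L / 2 - 1) * (2 * m') + 2 * m' = 2 ^ L * m' := by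
        have hd := Nat.div_add_mod (2 ^ L) 2
        rw [hNeven, add_zero] at hd
        zify [show 1 ≤ 2 ^ L / 2 by omega]
        have hz : ((2 ^ L : ℕ) : ℤ) = 2 * (2 ^ L / 2 : ℕ) := by exact_mod_cast hd.symm
        push_cast at hz ⊢
        nlinarith [hz]
      rw [show t / (2 * m') = 2 ^ L / 2 - 1 by omega] at hle
      omega

/-- **In the window the level-`4m'` condition holds with `2^L` in place of `2`** (`2^L ∣ ⌊tx₀/2m'⌋` for every unit `x₀ < 2m'`:
the coset test and the arc lemma, `t ≡ 1 (mod 2^L)` excluding the `−1` branch), **so `t = 1` — or `L = 1` and `t` is one of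
Gannon's level-`4m'` exceptions, or `(L, m', t) = (2, 3, 5)`** (`m = 24`: «`R_12 = {1,5,7,11}`»; `t = 2m' − 1` needs `2^L ∣ x₀ − 1` for
all units `x₀ < 2m'`, tested at `x₀ = m' − 2` or `m' − 4 ≡ 3 (mod 4)`). [cite: Gannon1996SU3Revisited, §2 Lemma 5]
[cite: GalleseGoodsonLombardo2024, §3.2 Lemma 12] -/
theorem eq_or_of_stab_of_lt (hL : 1 ≤ L) (hmdef : m = 2 * m' * 2 ^ L) (hhdef : h = 2 ^ L * m') (hm : Odd m')
    (hstab : ∀ c, c.Coprime m → c < m → (t * c % m < h ↔ c < h)) (htc : t.Coprime m) (ht2 : t < 2 * m')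
    (hmod : L = 1 ∨ t % 2 ^ L = 1) :
    t = 1 ∨ (L = 1 ∧ t = 2 * m' - 1) ∨ (L = 2 ∧ m' = 3 ∧ t = 5) ∨
      (L = 1 ∧ m' = 5 ∧ (t = 3 ∨ t = 7)) ∨ (L = 1 ∧ m' = 15 ∧ (t = 11 ∨ t = 19)) := by
  have hcos := fun {x₀ : ℕ} => forall_half_iff_coset (t := t) (x₀ := x₀) hL hmdef hhdef hstab
  have hm1 : m' % 2 = 1 := Nat.odd_iff.1 hm
  have hN0 : 0 < 2 ^ L := Nat.two_pow_pos L
  have hP : 2 ≤ 2 ^ L := by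
    calc (2 : ℕ) = 2 ^ 1 := by norm_num
      _ ≤ 2 ^ L := Nat.pow_le_pow_right (by norm_num) hL
  have htc2 : t.Coprime (2 * m') := htc.coprime_dvd_right ⟨2 ^ L, by rw [hmdef]⟩
  -- `2^L ∣ ⌊tx₀/2m'⌋` for every unit `x₀ < 2m'`
  have hdiv : ∀ x₀, x₀ % 2 = 1 → x₀.Coprime m' → x₀ < 2 * m' → 2 ^ L ∣ t * x₀ / (2 * m') := by
    intro x₀ hx1 hxc hx2
    have hx : x₀.Coprime (2 * m') := Nat.Coprime.mul_right (Nat.coprime_two_right.2 (Nat.odd_iff.2 hx1)) hxc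
    have hc := hcos hx hx2
    have hk0 : t * x₀ / (2 * m') % 2 ^ L < 2 ^ L / 2 := by
      have := (hc 0 hN0).2 (by omega)
      rwa [mul_zero, add_zero, Nat.mod_mod] at this
    generalize t * x₀ / (2 * m') = k at hc hk0 ⊢
    by_cases hL2 : 2 ≤ L
    · have ht1 : t % 2 ^ L = 1 := by
        rcases hmod with h1 | h1
        · omega
        · exact h1
      have h4 : 4 ≤ 2 ^ L := by
        calc (4 : ℕ) = 2 ^ 2 := by norm_num
          _ ≤ 2 ^ L := Nat.pow_le_pow_right (by norm_num) hL2
      have hNeven : 2 ^ L % 2 = 0 := by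
        obtain ⟨L', rfl⟩ : ∃ L', L = L' + 2 := ⟨L - 2, by omega⟩
        rw [pow_succ]; omega
      rcases mod_eq_one_or_of_forall_half_iff hNeven h4 (Nat.mod_lt k hN0) hc with ⟨-, hk⟩ | ⟨htm, -⟩
      · exact Nat.dvd_of_mod_eq_zero hk
      · omega
    · have hL1 : L = 1 := by omega
      subst hL1
      refine Nat.dvd_of_mod_eq_zero ?_
      norm_num at hk0 ⊢
      omega
  have hpar : ∀ x₀, x₀ % 2 = 1 → x₀.Coprime m' → x₀ < 2 * m' → t * x₀ / (2 * m') % 2 = 0 := fun x₀ hx1 hxc hx2 =>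
    Nat.mod_eq_zero_of_dvd (dvd_trans (dvd_pow_self 2 (by omega)) (hdiv x₀ hx1 hxc hx2))
  -- for `L ≥ 2`: `4 ∣ 2^L` and `t ≡ 1 (mod 4)`
  have hfour : 2 ≤ L → 4 ∣ 2 ^ L ∧ t % 4 = 1 := by
    intro hL2
    have h4 : 4 ∣ 2 ^ L := by
      have := pow_dvd_pow 2 hL2
      simpa using this
    refine ⟨h4, ?_⟩
    rcases hmod with h1 | h1
    · omega
    · rw [← Nat.mod_mod_of_dvd t h4, h1]
  rcases eq_or_of_forall_div_even hm htc2 ht2 hpar with h1 | h2m | ⟨h5, h37⟩ | ⟨h15, h1119⟩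
  · exact Or.inl h1
  · -- `t = 2m' − 1`
    by_cases hL1 : L = 1
    · exact Or.inr (Or.inl ⟨hL1, h2m⟩)
    obtain ⟨h4, -⟩ := hfour (by omega)
    by_cases hm'1 : m' = 1
    · left; omega
    by_cases hm'3 : m' = 3
    · -- `m = 24`: `2^L ∣ ⌊5·5/6⌋ = 4`
      subst hm'3
      have ht5 : t = 5 := by omega
      subst ht5
      have hd := hdiv 5 (by norm_num) (by norm_num) (by norm_num)
      norm_num at hd
      have hle : 2 ^ L ≤ 2 ^ 2 := Nat.le_of_dvd (by norm_num) hd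
      have hL2 : L ≤ 2 := (Nat.pow_le_pow_iff_right (by norm_num)).1 hle
      exact Or.inr (Or.inr (Or.inl ⟨by omega, rfl, rfl⟩))
    exfalso
    have hm5 : 5 ≤ m' := by omega
    rcases (show m' % 4 = 1 ∨ m' % 4 = 3 by omega) with hm4 | hm4
    · -- `x₀ = m' − 2 ≡ 3 (mod 4)`: `⌊t x₀/2m'⌋ = m' − 3 ≡ 2 (mod 4)`
      have hd := hdiv (m' - 2) (by omega) ((Nat.coprime_self_sub_left (by omega)).2 (Nat.coprime_two_left.2 hm))
        (by omega)
      have hval : t * (m' - 2) = (m' + 2) + 2 * m' * (m' - 3) := by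
        rw [h2m]; zify [show 1 ≤ 2 * m' by omega, show 2 ≤ m' by omega, show 3 ≤ m' by omega]; ring
      rw [hval, Nat.add_mul_div_left _ _ (by omega), Nat.div_eq_of_lt (by omega), zero_add] at hd
      have := dvd_trans h4 hd
      omega
    · -- `x₀ = m' − 4 ≡ 3 (mod 4)`: `⌊t x₀/2m'⌋ = m' − 5 ≡ 2 (mod 4)`
      have hm7 : 7 ≤ m' := by omega
      have hc4 : Nat.Coprime 4 m' := by
        have h := Nat.Coprime.pow_left 2 (Nat.coprime_two_left.2 hm)
        simpa using h
      have hd := hdiv (m' - 4) (by omega) ((Nat.coprime_self_sub_left (by omega)).2 hc4) (by omega)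
      have hval : t * (m' - 4) = (m' + 4) + 2 * m' * (m' - 5) := by
        rw [h2m]; zify [show 1 ≤ 2 * m' by omega, show 4 ≤ m' by omega, show 5 ≤ m' by omega]; ring
      rw [hval, Nat.add_mul_div_left _ _ (by omega), Nat.div_eq_of_lt (by omega), zero_add] at hd
      have := dvd_trans h4 hd
      omega
  · by_cases hL1 : L = 1
    · exact Or.inr (Or.inr (Or.inr (Or.inl ⟨hL1, h5, h37⟩)))
    · exfalso
      obtain ⟨-, ht4⟩ := hfour (by omega)
      omega
  · by_cases hL1 : L = 1
    · exact Or.inr (Or.inr (Or.inr (Or.inr ⟨hL1, h15, h1119⟩)))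
    · exfalso
      obtain ⟨-, ht4⟩ := hfour (by omega)
      omega

end Coset

/-! ## §4 On `ℤ/m`, `4 ∣ m`: the stabiliser of the lower half `{c ∈ (ℤ/m)ˣ : 2⟨c⟩ < m}` is `{1, m/2 − 1}` (`m ∉ {20, 24, 60}`) -/

section Residues

open CyclotomicCMTypeResidueSets

variable {m : ℕ} [NeZero m]

/-- At even level a unit residue has odd value. [folklore] -/
private theorem val_odd_of_mem_unitResidues (h2 : 2 ∣ m) {x : ZMod m} (hx : x ∈ unitResidues m) : x.val % 2 = 1 := by
  have hc := (coprime_iff_mem_unitResidues m x).2 hx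
  exact Nat.odd_iff.1 (Nat.coprime_two_right.1 (hc.coprime_dvd_right h2))

/-- **The symmetry `σ_{h−1}`** (`m = 2h`, `h` even): for a residue `x` of odd value, `⟨x·(h − 1)⟩ = h − ⟨x⟩` if `⟨x⟩ < h` and
`3h − ⟨x⟩` otherwise (`xh ≡ h (mod 2h)`); so multiplication by `h − 1` preserves the lower half — the element `m/2 − 1` of GGL's
stabiliser, `ζ ↦ −ζ̄`. [cite: GalleseGoodsonLombardo2024, §3.2 Lemma 12 and §3.3 («`β` restricts to a map `X_m → X_m`»)] -/
theorem val_mul_halfSubOne {h : ℕ} (hm : m = 2 * h) (hh : h % 2 = 0) {x : ZMod m} (hx : x.val % 2 = 1) :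
    (x * ((h - 1 : ℕ) : ZMod m)).val = if x.val < h then h - x.val else 3 * h - x.val := by
  have hlt : x.val < m := ZMod.val_lt x
  have hxeq : x = ((x.val : ℕ) : ZMod m) := (ZMod.natCast_zmod_val x).symm
  generalize x.val = a at hlt hxeq hx ⊢
  subst hxeq
  obtain ⟨b, rfl⟩ : ∃ b, a = 2 * b + 1 := ⟨a / 2, by omega⟩
  rw [← Nat.cast_mul, ZMod.val_natCast]
  split_ifs with hlo
  · have heq : (2 * b + 1) * (h - 1) = (h - (2 * b + 1)) + m * b := by
      subst hm; zify [hlo.le, show 1 ≤ h by omega]; ring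
    rw [heq, Nat.add_mul_mod_self_left, Nat.mod_eq_of_lt (by omega)]
  · have heq : (2 * b + 1) * (h - 1) = (3 * h - (2 * b + 1)) + m * (b - 1) := by
      subst hm; zify [show 2 * b + 1 ≤ 3 * h by omega, show 1 ≤ h by omega, show 1 ≤ b by omega]; ring
    rw [heq, Nat.add_mul_mod_self_left, Nat.mod_eq_of_lt (by omega)]

/-- `h − 1` is a unit modulo `m = 2h` (`h` even, `h ≥ 2`): the element `m/2 − 1 ∈ (ℤ/mℤ)ˣ` of GGL's stabiliser.
[cite: GalleseGoodsonLombardo2024, §3.2 Lemma 12] -/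
theorem halfSubOne_mem_unitResidues {h : ℕ} (hm : m = 2 * h) (hh : h % 2 = 0) (h2 : 2 ≤ h) :
    ((h - 1 : ℕ) : ZMod m) ∈ unitResidues m := by
  rw [← coprime_iff_mem_unitResidues, ZMod.val_natCast, Nat.mod_eq_of_lt (by omega), hm]
  refine Nat.Coprime.mul_right (Nat.coprime_two_right.2 (Nat.odd_iff.2 (by omega))) ?_
  exact (Nat.coprime_self_sub_left (by omega)).2 (Nat.coprime_one_left h)

/-- **`m/2 − 1` STABILISES THE LOWER HALF** (`4 ∣ m`): `2⟨c(h − 1)⟩ < m ⟺ 2⟨c⟩ < m` for every unit `c` — GGL Lemma 12's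
`{1, m/2 − 1} ⊆ Stab(Φ_m)`. [cite: GalleseGoodsonLombardo2024, §3.2 Lemma 12] -/
theorem two_mul_val_mul_halfSubOne_lt_iff {h : ℕ} (hm : m = 2 * h) (hh : h % 2 = 0) {c : ZMod m}
    (hc : c ∈ unitResidues m) : 2 * (c * ((h - 1 : ℕ) : ZMod m)).val < m ↔ 2 * c.val < m := by
  have hodd := val_odd_of_mem_unitResidues ⟨h, hm⟩ hc
  have hlt : c.val < m := ZMod.val_lt c
  rw [val_mul_halfSubOne hm hh hodd]
  split_ifs with hlo <;> omega

/-- The stabiliser condition on `ℤ/m` read on natural numbers. [folklore] -/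
private theorem stab_nat_of_stab {h : ℕ} (hm : m = 2 * h) {t : ZMod m}
    (hstab : ∀ c ∈ unitResidues m, (2 * (c * t).val < m ↔ 2 * c.val < m)) :
    ∀ c : ℕ, c.Coprime m → c < m → (t.val * c % m < h ↔ c < h) := by
  intro c hcop hclt
  have hcval : ((c : ℕ) : ZMod m).val = c := by rw [ZMod.val_natCast, Nat.mod_eq_of_lt hclt]
  have hmem : ((c : ℕ) : ZMod m) ∈ unitResidues m := by
    rw [← coprime_iff_mem_unitResidues, hcval]; exact hcop
  have key := hstab _ hmem
  have k1 : (((c : ℕ) : ZMod m) * t).val = t.val * c % m := by rw [ZMod.val_mul, hcval, mul_comm]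
  rw [k1, hcval] at key
  omega

/-- A product of unit residues is a unit residue. [folklore] -/
private theorem mul_mem_unitResidues' {a b : ZMod m} (ha : a ∈ unitResidues m) (hb : b ∈ unitResidues m) :
    a * b ∈ unitResidues m := by
  rw [mem_unitResidues_iff_isUnit] at ha hb ⊢
  exact ha.mul hb

/-- **GGL 2024 LEMMA 12 FOR `4 ∣ m`, `m ∉ {20, 24, 60}` (Gannon 1996 Lemma 5 (a)), on `ℤ/m`: a unit `t` with `2⟨ct⟩ < m ⟺ 2⟨c⟩ < m`
for all units `c` — a stabiliser of the lower half `H_m = {c ∈ (ℤ/m)ˣ : ⟨c⟩ < m/2}`, the residue set of the CM type `Φ_m` of `X_m`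
— is `1` or `m/2 − 1`** («`{1, m/2 − 1}`, if `4 ∣ m` and `m ≠ 20, 24, 60`»).  PROOF (this file's, replacing Gannon's digit cases
2–3 (i)–(iv) by a 2-adic reduction): write `m = 2^{L+1}m'`, `m'` odd; the coset test at `x₀ = 1` and the arc lemma put `t` (up to
`t ↦ (m/2 − 1)t ≡ m/2 − t`) in the window `t < 2m'` with `2^L ∣ ⌊tx₀/2m'⌋` for all units `x₀ < 2m'`; Gannon's level-`4m'` argument
(binary digits of `t/m'`, Case 3 (v)) leaves `t = 1`, `t = 2m' − 1` (killed for `L ≥ 2` unless `m = 24`) and the level-`20`, `60`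
exceptions. [cite: GalleseGoodsonLombardo2024, §3.2 Lemma 12] [cite: Gannon1996SU3Revisited, §2 Lemma 5 (a)] -/
theorem eq_one_or_eq_halfSubOne_of_forall_iff (h4 : 4 ∣ m) (h20 : m ≠ 20) (h24 : m ≠ 24) (h60 : m ≠ 60)
    {t : ZMod m} (ht : t ∈ unitResidues m) (hstab : ∀ c ∈ unitResidues m, (2 * (c * t).val < m ↔ 2 * c.val < m)) :
    t = 1 ∨ t = ((m / 2 - 1 : ℕ) : ZMod m) := by
  obtain ⟨k, m', hm', hmk⟩ := Nat.exists_eq_two_pow_mul_odd (NeZero.ne m)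
  have hm1 : m' % 2 = 1 := Nat.odd_iff.1 hm'
  have hk2 : 2 ≤ k := by
    by_contra hk
    interval_cases k <;> omega
  obtain ⟨L, rfl⟩ : ∃ L, k = L + 1 := ⟨k - 1, by omega⟩
  have hL : 1 ≤ L := by omega
  have hmdef : m = 2 * m' * 2 ^ L := by rw [hmk, pow_succ]; ring
  set h := 2 ^ L * m' with hhdef
  have hmh : m = 2 * h := by rw [hmdef, hhdef]; ring
  have hm2 : m / 2 = h := by rw [hmh]; omega
  have hP : 2 ≤ 2 ^ L := by
    calc (2 : ℕ) = 2 ^ 1 := by norm_num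
      _ ≤ 2 ^ L := Nat.pow_le_pow_right (by norm_num) hL
  have hNeven : 2 ^ L % 2 = 0 := by
    obtain ⟨L', rfl⟩ : ∃ L', L = L' + 1 := ⟨L - 1, by omega⟩
    rw [pow_succ]; omega
  have hheven : h % 2 = 0 := by rw [hhdef, Nat.mul_mod, hNeven]; simp
  have hh2 : 2 ≤ h := by
    have := Nat.mul_le_mul hP (show 1 ≤ m' by omega)
    rw [hhdef]; omega
  rw [hm2]
  -- to natural numbers
  have htv : t.val.Coprime m := (coprime_iff_mem_unitResidues m t).2 ht
  have htlt : t.val < m := ZMod.val_lt t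
  have hstabN := stab_nat_of_stab hmh hstab
  have back : ∀ {s : ZMod m}, s.val = 1 → s = 1 := fun {s} hs => by
    rw [← ZMod.natCast_zmod_val s, hs, Nat.cast_one]
  have back' : ∀ {s : ZMod m} {a : ℕ}, s.val = a → s = (a : ZMod m) := fun {s a} hs => by
    rw [← ZMod.natCast_zmod_val s, hs]
  rcases (window_of_stab hL hmdef hhdef.symm (by omega) hstabN htlt).2 with ⟨ht2, hmod⟩ | ⟨hge, hmod, hL2⟩
  · rcases eq_or_of_stab_of_lt hL hmdef hhdef.symm hm' hstabN htv ht2 hmod with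
      h1 | ⟨hL1, h2⟩ | ⟨hL2, h3, -⟩ | ⟨hL1, h5, -⟩ | ⟨hL1, h15, -⟩
    · exact Or.inl (back h1)
    · subst hL1
      refine Or.inr (back' ?_)
      rw [h2, hhdef]; ring_nf
    · exfalso; apply h24; rw [hmdef, hL2, h3]; norm_num
    · exfalso; apply h20; rw [hmdef, hL1, h5]; norm_num
    · exfalso; apply h60; rw [hmdef, hL1, h15]; norm_num
  · -- reflect by `h − 1`
    obtain ⟨hth, -⟩ := window_of_stab hL hmdef hhdef.symm (by omega) hstabN htlt
    have hs := halfSubOne_mem_unitResidues hmh hheven hh2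
    set t' := t * ((h - 1 : ℕ) : ZMod m) with ht'
    have ht'mem : t' ∈ unitResidues m := mul_mem_unitResidues' ht hs
    have ht'val : t'.val = h - t.val := by
      rw [ht', val_mul_halfSubOne hmh hheven (val_odd_of_mem_unitResidues ⟨h, hmh⟩ ht), if_pos hth]
    have hstab' : ∀ c ∈ unitResidues m, (2 * (c * t').val < m ↔ 2 * c.val < m) := by
      intro c hc
      rw [ht', ← mul_assoc, two_mul_val_mul_halfSubOne_lt_iff hmh hheven (mul_mem_unitResidues' hc ht)]
      exact hstab c hc
    have hstabN' := stab_nat_of_stab hmh hstab'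
    rw [ht'val] at hstabN'
    have htodd := val_odd_of_mem_unitResidues ⟨h, hmh⟩ ht
    have ht2' : h - t.val < 2 * m' := by omega
    have htv' : (h - t.val).Coprime m := by
      have := (coprime_iff_mem_unitResidues m t').2 ht'mem
      rwa [ht'val] at this
    have hmod' : L = 1 ∨ (h - t.val) % 2 ^ L = 1 := by
      right
      have hd := Nat.div_add_mod t.val (2 ^ L)
      rw [hmod] at hd
      have hd' : 2 ^ L * (t.val / 2 ^ L) + 2 ^ L = t.val + 1 := by
        generalize 2 ^ L * (t.val / 2 ^ L) = Pq at hd ⊢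
        omega
      have hq : t.val / 2 ^ L + 1 ≤ m' := by
        by_contra hq
        have := Nat.mul_le_mul_left (2 ^ L) (show m' ≤ t.val / 2 ^ L by omega)
        omega
      have hth' : t.val ≤ 2 ^ L * m' := by rw [← hhdef]; exact hth.le
      have heq : h - t.val = 1 + 2 ^ L * (m' - (t.val / 2 ^ L + 1)) := by
        rw [hhdef]
        zify [hth', hq]
        have hz : ((2 ^ L : ℕ) : ℤ) * (t.val / 2 ^ L : ℕ) + (2 ^ L : ℕ) = (t.val : ℕ) + 1 := by exact_mod_cast hd'
        push_cast at hz ⊢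
        linear_combination hz
      rw [heq, Nat.add_mul_mod_self_left, Nat.mod_eq_of_lt (by omega)]
    rcases eq_or_of_stab_of_lt hL hmdef hhdef.symm hm' hstabN' htv' ht2' hmod' with
      h1 | ⟨hL1, -⟩ | ⟨hL2', h3, -⟩ | ⟨hL1, -⟩ | ⟨hL1, -⟩
    · refine Or.inr (back' ?_)
      omega
    · omega
    · exfalso; apply h24; rw [hmdef, hL2', h3]; norm_num
    · omega
    · omega

/-- **LEMMA 12, `4 ∣ m`, `m ∉ {20, 24, 60}`, both inclusions: the stabiliser of the lower half of `(ℤ/m)ˣ` is EXACTLY `{1, m/2 − 1}`.**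
[cite: GalleseGoodsonLombardo2024, §3.2 Lemma 12] [cite: Gannon1996SU3Revisited, §2 Lemma 5 (a)] -/
theorem forall_iff_iff_eq_one_or_eq_halfSubOne (h4 : 4 ∣ m) (h20 : m ≠ 20) (h24 : m ≠ 24) (h60 : m ≠ 60)
    {t : ZMod m} (ht : t ∈ unitResidues m) :
    (∀ c ∈ unitResidues m, (2 * (c * t).val < m ↔ 2 * c.val < m)) ↔ (t = 1 ∨ t = ((m / 2 - 1 : ℕ) : ZMod m)) := by
  refine ⟨eq_one_or_eq_halfSubOne_of_forall_iff h4 h20 h24 h60 ht, ?_⟩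
  rintro (rfl | rfl) c hc
  · rw [mul_one]
  · obtain ⟨q, hq⟩ := h4
    exact two_mul_val_mul_halfSubOne_lt_iff (h := m / 2) (by omega) (by omega) hc

/-- **LEMMA 12, `m = 20`: the stabiliser of the lower half `{1, 3, 7, 9}` of `(ℤ/20)ˣ` is `{1, 3, 7, 9}`** (a finite check).
[cite: GalleseGoodsonLombardo2024, §3.2 Lemma 12] [cite: Gannon1996SU3Revisited, §2 Lemma 5 (b) (`R_10`)] -/
theorem stabilizer_half_twenty :
    ((unitResidues 20).filter fun t => ∀ c ∈ unitResidues 20, (2 * (c * t).val < 20 ↔ 2 * c.val < 20)) =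
      {1, 3, 7, 9} := by
  decide

/-- **LEMMA 12, `m = 24`: the stabiliser of the lower half `{1, 5, 7, 11}` of `(ℤ/24)ˣ` is `{1, 5, 7, 11}`** (a finite check).
[cite: GalleseGoodsonLombardo2024, §3.2 Lemma 12] [cite: Gannon1996SU3Revisited, §2 Lemma 5 (b) (`R_12`)] -/
theorem stabilizer_half_twentyFour :
    ((unitResidues 24).filter fun t => ∀ c ∈ unitResidues 24, (2 * (c * t).val < 24 ↔ 2 * c.val < 24)) =
      {1, 5, 7, 11} := by
  decide

/-- **LEMMA 12, `m = 60`: the stabiliser of the lower half of `(ℤ/60)ˣ` is `{1, 11, 19, 29}`** (a finite check).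
[cite: GalleseGoodsonLombardo2024, §3.2 Lemma 12] [cite: Gannon1996SU3Revisited, §2 Lemma 5 (b) (`R_30`)] -/
theorem stabilizer_half_sixty :
    ((unitResidues 60).filter fun t => ∀ c ∈ unitResidues 60, (2 * (c * t).val < 60 ↔ 2 * c.val < 60)) =
      {1, 11, 19, 29} := by
  decide

end Residues

/-! ## §5 On the CM type `Φ_m = {σ : 2⟨e(σ)⟩ < m}` of `X_m` (`4 ∣ m`): Shimura's `H'` is `{1, σ_{m/2−1}}` (order `4` at
## `20, 24, 60`), `Φ_m` is not primitive, `X_m` is not simple, and `Φ_m` is induced from a primitive type of index `2` (resp. `4`) -/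

section CMType

open CategoryTheory
open NumberField
open Literature.NumberTheory.ComplexMultiplication
open Literature.AlgebraicGeometry.Motives (CMType AbelianVariety)
open Literature.AlgebraicGeometry.HodgeTheory (complexBetti)
open Literature.AlgebraicGeometry.Pohlmann1968 Literature.AlgebraicGeometry.Pohlmann1968.Cyclotomic
open CyclotomicCMTypeResidueSets

variable {m : ℕ} [NeZero m] {K : Type} [Field K] [NumberField K] [IsCyclotomicExtension {m} ℚ K]

/-- The residue set of the lower-half type is the lower half of the units. [cite: GalleseGoodsonLombardo2024, §3.1 Lemma 11]
[cite: Shimura1998, §8.4 Example (1)] -/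
theorem mem_residueSet_half_iff (Φ : CMType K) (hΦ : ∀ σ : K →+* ℂ, σ ∈ Φ.1 ↔ 2 * (expOf m K σ).val < m)
    (c : ZMod m) : c ∈ residueSet m Φ ↔ c ∈ unitResidues m ∧ 2 * c.val < m := by
  rw [mem_residueSet_iff]
  constructor
  · rintro ⟨σ, hσ, rfl⟩
    exact ⟨(coprime_iff_mem_unitResidues m _).1 (coprime_expOf m K σ), (hΦ σ).1 hσ⟩
  · rintro ⟨hc, hlt⟩
    obtain ⟨σ, hσ⟩ := exists_expOf_eq m K c ((coprime_iff_mem_unitResidues m c).2 hc)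
    exact ⟨σ, (hΦ σ).2 (by rw [hσ]; exact hlt), hσ⟩

/-- Stabilising the residue set of the lower-half type `Φ_m` (Lemma 11: `{σ_j : (j, m) = 1, 1 ≤ j ≤ g(m)}`, Shimura's `S ⊂ (ℤ/m)ˣ`)
= preserving the lower half of the units. [cite: GalleseGoodsonLombardo2024, §3.1 Lemma 11 and §3.2 Lemma 12]
[cite: Shimura1998, §8.4 Example (1)] -/
theorem forall_mem_residueSet_half_iff (Φ : CMType K) (hΦ : ∀ σ : K →+* ℂ, σ ∈ Φ.1 ↔ 2 * (expOf m K σ).val < m)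
    {t : ZMod m} (ht : t ∈ unitResidues m) :
    (∀ c ∈ unitResidues m, (c * t ∈ residueSet m Φ ↔ c ∈ residueSet m Φ)) ↔
      ∀ c ∈ unitResidues m, (2 * (c * t).val < m ↔ 2 * c.val < m) := by
  refine forall₂_congr fun c hc => ?_
  rw [mem_residueSet_half_iff Φ hΦ, mem_residueSet_half_iff Φ hΦ]
  have hct := mul_mem_unitResidues' hc ht
  tauto

/-- **GGL LEMMA 12 (`4 ∣ m`, `m ∉ {20, 24, 60}`) ON THE TYPE: a unit `t` stabilises the residue set of the lower-half type `Φ_m` of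
`ℚ(ζ_m)` iff `t ∈ {1, m/2 − 1}`** — Shimura's `H' = {γ : γS = S} = {1, σ_{m/2−1}} = Gal(ℚ(ζ_m)/ℚ(ζ_m − ζ_m^{−1}))`, the group
whose fixed field `ℚ(ζ_d − ζ_d^{−1})` is the CM field of `Y_d` in Thm. 3.0 (5). [cite: GalleseGoodsonLombardo2024, §3.2 Lemma 12
and §3.3] [cite: Gannon1996SU3Revisited, §2 Lemma 5 (a)] [cite: Shimura1998, §8.2 Prop. 26] -/
theorem forall_mem_residueSet_half_iff_eq_one_or (h4 : 4 ∣ m) (h20 : m ≠ 20) (h24 : m ≠ 24) (h60 : m ≠ 60) (Φ : CMType K)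
    (hΦ : ∀ σ : K →+* ℂ, σ ∈ Φ.1 ↔ 2 * (expOf m K σ).val < m) {t : ZMod m} (ht : t ∈ unitResidues m) :
    (∀ c ∈ unitResidues m, (c * t ∈ residueSet m Φ ↔ c ∈ residueSet m Φ)) ↔ (t = 1 ∨ t = ((m / 2 - 1 : ℕ) : ZMod m)) := by
  rw [forall_mem_residueSet_half_iff Φ hΦ ht]
  exact forall_iff_iff_eq_one_or_eq_halfSubOne h4 h20 h24 h60 ht

/-- **`Φ_m` HAS A NON-TRIVIAL STABILISER for `4 ∣ m`, `m ≥ 8`** (`m/2 − 1 ≠ 1` stabilises).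
[cite: GalleseGoodsonLombardo2024, §3.2 Lemma 12 and §3.3 («When `m` is a multiple of `4`, … `X_m` is not geometrically irreducible»)] -/
theorem not_hasTrivialStabilizer_half (h4 : 4 ∣ m) (h8 : 8 ≤ m) (Φ : CMType K)
    (hΦ : ∀ σ : K →+* ℂ, σ ∈ Φ.1 ↔ 2 * (expOf m K σ).val < m) : ¬HasTrivialStabilizer m (residueSet m Φ) := by
  intro hT
  obtain ⟨q, hq⟩ := h4
  have hs := halfSubOne_mem_unitResidues (m := m) (h := m / 2) (by omega) (by omega) (by omega)
  have h1 := hT _ hs ((forall_mem_residueSet_half_iff Φ hΦ hs).2 fun c hc =>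
    two_mul_val_mul_halfSubOne_lt_iff (h := m / 2) (by omega) (by omega) hc)
  have h2 := congrArg ZMod.val h1
  rw [ZMod.val_natCast, ZMod.val_one_eq_one_mod, Nat.mod_eq_of_lt (show m / 2 - 1 < m by omega),
    Nat.mod_eq_of_lt (show 1 < m by omega)] at h2
  omega

/-- **`Φ_m` IS NOT PRIMITIVE (`4 ∣ m`, `m ≥ 8`)** — Shimura §8.2 Prop. 26 read on residues.
[cite: GalleseGoodsonLombardo2024, §3 Thm. 3.0 (5)–(6) and §3.3] [cite: Shimura1998, §8.2 Prop. 26] -/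
theorem not_isPrimitive_half (h4 : 4 ∣ m) (h8 : 8 ≤ m) (Φ : CMType K)
    (hΦ : ∀ σ : K →+* ℂ, σ ∈ Φ.1 ↔ 2 * (expOf m K σ).val < m) (φ₀ : K →+* ℂ) : ¬IsPrimitive (ℂ ≃+* ℂ) Φ.1 φ₀ := by
  rw [isPrimitive_iff_hasTrivialStabilizer m Φ φ₀]
  exact not_hasTrivialStabilizer_half h4 h8 Φ hΦ

variable {A : AbelianVariety ℂ} {ι : 𝓞 K →+* End A} {θ : K →+* Module.End ℂ (complexBetti A.X 1)}

/-- **GGL THM. 3.0 (5)–(6), first clause: for `4 ∣ d`, `d ≥ 8`, `X_d` IS NOT SIMPLE** — no abelian variety realising the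
lower-half type `(ℚ(ζ_d); Φ_d)` on `H¹` is simple («`X_d ∼ Y_d²`», «`X_d ∼ Y_d⁴`»; §3.3 «When `m` is a multiple of `4`, the abelian
variety `X_m` is not geometrically irreducible»). [cite: GalleseGoodsonLombardo2024, §3 Thm. 3.0 (5)–(6) and §3.3]
[cite: Shimura1998, §8.2 Prop. 26] -/
theorem not_isSimple_of_four_dvd (h4 : 4 ∣ m) (h8 : 8 ≤ m) (Φ : CMType K)
    (hΦ : ∀ σ : K →+* ℂ, σ ∈ Φ.1 ↔ 2 * (expOf m K σ).val < m) (hA : IsCMTypeRealisation Φ A ι θ) : ¬A.IsSimple := by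
  obtain ⟨φ₀⟩ := (inferInstance : Nonempty (K →+* ℂ))
  exact not_isSimple_of_isCMTypeRealisation_of_not_isPrimitive hA φ₀ (not_isPrimitive_half h4 h8 Φ hΦ φ₀)

/-- **A pattern class of `Φ` is a coset of the stabiliser**: the embeddings `t` with `τ ∘ s ∈ Φ ⟺ τ ∘ t ∈ Φ` (all `τ ∈ Aut(ℂ)`)
are those with `e(t)e(s)⁻¹` in the stabiliser of the residue set, so each pattern class has as many elements as the stabiliser
(Shimura's `[H' : H₁]`). [cite: Shimura1998, §8.2 (proof of Prop. 26)] -/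
theorem ncard_setOf_pattern_eq_card_stabilizer (Φ : CMType K) (s : K →+* ℂ) :
    {t : K →+* ℂ | ∀ τ : ℂ ≃+* ℂ, (τ : ℂ →+* ℂ).comp s ∈ Φ.1 ↔ (τ : ℂ →+* ℂ).comp t ∈ Φ.1}.ncard =
      ((unitResidues m).filter fun v => ∀ c ∈ unitResidues m,
        (c * v ∈ residueSet m Φ ↔ c ∈ residueSet m Φ)).card := by
  classical
  set cs : ZMod m := expOf m K s with hcs
  have hcsU : IsUnit cs := by
    rw [hcs, ← ZMod.natCast_zmod_val (expOf m K s)]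
    exact (ZMod.isUnit_iff_coprime _ _).2 (coprime_expOf m K s)
  have hinvU : IsUnit (cs⁻¹ : ZMod m) := IsUnit.of_mul_eq_one cs (ZMod.inv_mul_of_unit cs hcsU)
  have hinv_mem : (cs⁻¹ : ZMod m) ∈ unitResidues m := (mem_unitResidues_iff_isUnit _).2 hinvU
  have hcs_mem : cs ∈ unitResidues m := (mem_unitResidues_iff_isUnit _).2 hcsU
  -- the pattern of `t` relative to `s` ⟺ `e(t)e(s)⁻¹` stabilises `S`
  have hpat : ∀ t : K →+* ℂ, (∀ τ : ℂ ≃+* ℂ, (τ : ℂ →+* ℂ).comp s ∈ Φ.1 ↔ (τ : ℂ →+* ℂ).comp t ∈ Φ.1) ↔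
      ∀ c ∈ unitResidues m, (c * (expOf m K t * cs⁻¹) ∈ residueSet m Φ ↔ c ∈ residueSet m Φ) := by
    intro t
    constructor
    · intro h c hc
      obtain ⟨τ, hτ⟩ := exists_autExp_eq m (c * cs⁻¹)
        ((coprime_iff_mem_unitResidues m (c * cs⁻¹)).2 (mul_mem_unitResidues' hc hinv_mem))
      have h1 : expOf m K ((τ : ℂ →+* ℂ).comp s) = c := by
        rw [expOf_comp, hτ, mul_assoc, ZMod.inv_mul_of_unit cs hcsU, mul_one]
      have h2 : expOf m K ((τ : ℂ →+* ℂ).comp t) = c * (expOf m K t * cs⁻¹) := by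
        rw [expOf_comp, hτ]; ring
      have key := h τ
      rw [← expOf_mem_residueSet_iff m Φ, ← expOf_mem_residueSet_iff m Φ ((τ : ℂ →+* ℂ).comp t), h1, h2] at key
      exact key.symm
    · intro h τ
      rw [← expOf_mem_residueSet_iff m Φ, ← expOf_mem_residueSet_iff m Φ ((τ : ℂ →+* ℂ).comp t), expOf_comp,
        expOf_comp]
      have hu : autExp m τ * cs ∈ unitResidues m :=
        mul_mem_unitResidues' ((coprime_iff_mem_unitResidues m _).1 (coprime_autExp m τ)) hcs_mem
      have key := h _ hu
      rw [show autExp m τ * cs * (expOf m K t * cs⁻¹) = autExp m τ * expOf m K t * (cs * cs⁻¹) by ring,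
        ZMod.mul_inv_of_unit cs hcsU, mul_one] at key
      exact key.symm
  -- the bijection `t ↦ e(t)e(s)⁻¹`
  set f : (K →+* ℂ) → ZMod m := fun t => expOf m K t * cs⁻¹ with hf
  have hfinj : Function.Injective f := by
    intro t t' h
    apply expOf_injective m K
    have h' : expOf m K t * cs⁻¹ * cs = expOf m K t' * cs⁻¹ * cs := by
      simp only [hf] at h; rw [h]
    rwa [mul_assoc, mul_assoc, ZMod.inv_mul_of_unit cs hcsU, mul_one, mul_one] at h'
  have himage : f '' {t : K →+* ℂ | ∀ τ : ℂ ≃+* ℂ, (τ : ℂ →+* ℂ).comp s ∈ Φ.1 ↔ (τ : ℂ →+* ℂ).comp t ∈ Φ.1} =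
      ↑((unitResidues m).filter fun v => ∀ c ∈ unitResidues m, (c * v ∈ residueSet m Φ ↔ c ∈ residueSet m Φ)) := by
    ext v
    simp only [Set.mem_image, Set.mem_setOf_eq, Finset.coe_filter]
    constructor
    · rintro ⟨t, ht, rfl⟩
      exact ⟨mul_mem_unitResidues' ((coprime_iff_mem_unitResidues m _).1 (coprime_expOf m K t)) hinv_mem,
        (hpat t).1 ht⟩
    · rintro ⟨hv, hstab⟩
      obtain ⟨t, ht⟩ :=
        exists_expOf_eq m K (v * cs) ((coprime_iff_mem_unitResidues m (v * cs)).2 (mul_mem_unitResidues' hv hcs_mem))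
      have hft : f t = v := by
        simp only [hf]; rw [ht, mul_assoc, ZMod.mul_inv_of_unit cs hcsU, mul_one]
      refine ⟨t, (hpat t).2 ?_, hft⟩
      simp only [hf] at hft
      rw [hft]
      exact hstab
  rw [← Set.ncard_image_of_injective _ hfinj, himage, Set.ncard_coe_finset]

/-- **For `4 ∣ d`, `d ∉ {20, 24, 60}`, `d ≥ 8`, every pattern class of `Φ_d` has exactly TWO elements** (`[H' : H₁] = 2`).
[cite: GalleseGoodsonLombardo2024, §3 Thm. 3.0 (5) and Lemma 12] [cite: Shimura1998, §8.2 Prop. 26] -/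
theorem ncard_setOf_pattern_half_eq_two (h4 : 4 ∣ m) (h8 : 8 ≤ m) (h20 : m ≠ 20) (h24 : m ≠ 24) (h60 : m ≠ 60)
    (Φ : CMType K) (hΦ : ∀ σ : K →+* ℂ, σ ∈ Φ.1 ↔ 2 * (expOf m K σ).val < m) (s : K →+* ℂ) :
    {t : K →+* ℂ | ∀ τ : ℂ ≃+* ℂ, (τ : ℂ →+* ℂ).comp s ∈ Φ.1 ↔ (τ : ℂ →+* ℂ).comp t ∈ Φ.1}.ncard = 2 := by
  classical
  rw [ncard_setOf_pattern_eq_card_stabilizer (m := m) Φ s]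
  obtain ⟨q, hq⟩ := h4
  have hs := halfSubOne_mem_unitResidues (m := m) (h := m / 2) (by omega) (by omega) (by omega)
  have h1 : (1 : ZMod m) ∈ unitResidues m := by
    rw [← coprime_iff_mem_unitResidues, ZMod.val_one_eq_one_mod, Nat.mod_eq_of_lt (show 1 < m by omega)]
    exact Nat.coprime_one_left m
  have hne : (1 : ZMod m) ≠ ((m / 2 - 1 : ℕ) : ZMod m) := by
    intro h
    have h2 := congrArg ZMod.val h
    rw [ZMod.val_natCast, ZMod.val_one_eq_one_mod, Nat.mod_eq_of_lt (show m / 2 - 1 < m by omega),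
      Nat.mod_eq_of_lt (show 1 < m by omega)] at h2
    omega
  have hset : ((unitResidues m).filter fun v => ∀ c ∈ unitResidues m,
      (c * v ∈ residueSet m Φ ↔ c ∈ residueSet m Φ)) = {1, ((m / 2 - 1 : ℕ) : ZMod m)} := by
    ext v
    rw [Finset.mem_filter, Finset.mem_insert, Finset.mem_singleton]
    constructor
    · rintro ⟨hv, hstab⟩
      exact (forall_mem_residueSet_half_iff_eq_one_or ⟨q, hq⟩ h20 h24 h60 Φ hΦ hv).1 hstab
    · rintro (rfl | rfl)
      · exact ⟨h1, (forall_mem_residueSet_half_iff_eq_one_or ⟨q, hq⟩ h20 h24 h60 Φ hΦ h1).2 (Or.inl rfl)⟩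
      · exact ⟨hs, (forall_mem_residueSet_half_iff_eq_one_or ⟨q, hq⟩ h20 h24 h60 Φ hΦ hs).2 (Or.inr rfl)⟩
  rw [hset, Finset.card_pair hne]

/-- **GGL THM. 3.0 (5) ON TYPES: for `4 ∣ d`, `d ∉ {20, 24, 60}`, `d ≥ 8`, the type `Φ_d` of `X_d` is induced from a PRIMITIVE CM
type on a subfield `K₁ ⊂ ℚ(ζ_d)` of INDEX `2`** — the CM field of the simple `Y_d` with `X_d ∼ Y_d²` (in print `K₁ = ℚ(ζ_d − ζ_d^{−1})`,
the fixed field of `{1, d/2 − 1}`; the identification of `K₁` is not typed; the subfield is unique, tree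
`eq_of_primitive_of_inducedCMType_eq`). [cite: GalleseGoodsonLombardo2024, §3 Thm. 3.0 (5) and §3.3] [cite: Shimura1998, §8.2 Prop. 26] -/
theorem exists_primitive_inducedCMType_index_two_of_four_dvd (h4 : 4 ∣ m) (h8 : 8 ≤ m) (h20 : m ≠ 20) (h24 : m ≠ 24) (h60 : m ≠ 60)
    (Φ : CMType K) (hΦ : ∀ σ : K →+* ℂ, σ ∈ Φ.1 ↔ 2 * (expOf m K σ).val < m) :
    ∃ (K₁ : IntermediateField ℚ K) (Φ₁ : CMType K₁),
      inducedCMType (algebraMap K₁ K) Φ₁ = Φ ∧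
      (∀ s t : K₁ →+* ℂ,
        (∀ τ : ℂ ≃+* ℂ, (τ : ℂ →+* ℂ).comp s ∈ Φ₁.1 ↔ (τ : ℂ →+* ℂ).comp t ∈ Φ₁.1) → s = t) ∧
      Module.finrank K₁ K = 2 := by
  obtain ⟨s⟩ := (inferInstance : Nonempty (K →+* ℂ))
  exact exists_primitive_inducedCMType_finrank_eq Φ (ncard_setOf_pattern_half_eq_two h4 h8 h20 h24 h60 Φ hΦ s)

/-- The pattern classes of the lower-half type, counted on `ℤ/m`. [cite: Shimura1998, §8.2 (proof of Prop. 26)] -/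
theorem ncard_setOf_pattern_half_eq_card (Φ : CMType K) (hΦ : ∀ σ : K →+* ℂ, σ ∈ Φ.1 ↔ 2 * (expOf m K σ).val < m)
    (s : K →+* ℂ) :
    {t : K →+* ℂ | ∀ τ : ℂ ≃+* ℂ, (τ : ℂ →+* ℂ).comp s ∈ Φ.1 ↔ (τ : ℂ →+* ℂ).comp t ∈ Φ.1}.ncard =
      ((unitResidues m).filter fun t => ∀ c ∈ unitResidues m, (2 * (c * t).val < m ↔ 2 * c.val < m)).card := by
  rw [ncard_setOf_pattern_eq_card_stabilizer (m := m) Φ s]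
  congr 1
  exact Finset.filter_congr fun t ht => forall_mem_residueSet_half_iff Φ hΦ ht

/-- **`m = 20`: every pattern class of `Φ_{20} = {1, 3, 7, 9}` has FOUR elements** (`H' = {1, 3, 7, 9}`).
[cite: GalleseGoodsonLombardo2024, §3 Thm. 3.0 (6) and Lemma 12] [cite: Shimura1998, §8.2 Prop. 26] -/
theorem ncard_setOf_pattern_half_twenty {K : Type} [Field K] [NumberField K] [IsCyclotomicExtension {20} ℚ K]
    (Φ : CMType K) (hΦ : ∀ σ : K →+* ℂ, σ ∈ Φ.1 ↔ 2 * (expOf 20 K σ).val < 20) (s : K →+* ℂ) :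
    {t : K →+* ℂ | ∀ τ : ℂ ≃+* ℂ, (τ : ℂ →+* ℂ).comp s ∈ Φ.1 ↔ (τ : ℂ →+* ℂ).comp t ∈ Φ.1}.ncard = 4 := by
  rw [ncard_setOf_pattern_half_eq_card Φ hΦ s, stabilizer_half_twenty]
  decide

/-- **`m = 24`: every pattern class of `Φ_{24} = {1, 5, 7, 11}` has FOUR elements** (`H' = {1, 5, 7, 11}`).
[cite: GalleseGoodsonLombardo2024, §3 Thm. 3.0 (6) and Lemma 12] [cite: Shimura1998, §8.2 Prop. 26] -/
theorem ncard_setOf_pattern_half_twentyFour {K : Type} [Field K] [NumberField K] [IsCyclotomicExtension {24} ℚ K]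
    (Φ : CMType K) (hΦ : ∀ σ : K →+* ℂ, σ ∈ Φ.1 ↔ 2 * (expOf 24 K σ).val < 24) (s : K →+* ℂ) :
    {t : K →+* ℂ | ∀ τ : ℂ ≃+* ℂ, (τ : ℂ →+* ℂ).comp s ∈ Φ.1 ↔ (τ : ℂ →+* ℂ).comp t ∈ Φ.1}.ncard = 4 := by
  rw [ncard_setOf_pattern_half_eq_card Φ hΦ s, stabilizer_half_twentyFour]
  decide

/-- **`m = 60`: every pattern class of `Φ_{60}` has FOUR elements** (`H' = {1, 11, 19, 29}`).
[cite: GalleseGoodsonLombardo2024, §3 Thm. 3.0 (6) and Lemma 12] [cite: Shimura1998, §8.2 Prop. 26] -/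
theorem ncard_setOf_pattern_half_sixty {K : Type} [Field K] [NumberField K] [IsCyclotomicExtension {60} ℚ K]
    (Φ : CMType K) (hΦ : ∀ σ : K →+* ℂ, σ ∈ Φ.1 ↔ 2 * (expOf 60 K σ).val < 60) (s : K →+* ℂ) :
    {t : K →+* ℂ | ∀ τ : ℂ ≃+* ℂ, (τ : ℂ →+* ℂ).comp s ∈ Φ.1 ↔ (τ : ℂ →+* ℂ).comp t ∈ Φ.1}.ncard = 4 := by
  rw [ncard_setOf_pattern_half_eq_card Φ hΦ s, stabilizer_half_sixty]
  decide

end CMType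

/-! ## §6 On abelian varieties (Shimura §6.2 Thm. 3, §8.2 Prop. 26): `X_d ∼ Y_d^h` with `Y_d` SIMPLE, its CM field of index `2`
## in `ℚ(ζ_d)` (`4 ∣ d ∉ {20, 24, 60}`), resp. of index `4` (`d = 20, 24, 60`) -/

section Varieties

open CategoryTheory CategoryTheory.Limits
open NumberField
open Literature.NumberTheory.ComplexMultiplication
open Literature.AlgebraicGeometry.Motives (CMType AbelianVariety)
open Literature.AlgebraicGeometry.HodgeTheory (complexBetti)
open Literature.AlgebraicGeometry.Pohlmann1968 Literature.AlgebraicGeometry.Pohlmann1968.Cyclotomic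
open CyclotomicCMTypeResidueSets

variable {m : ℕ} [NeZero m] {K : Type} [Field K] [NumberField K] [IsCyclotomicExtension {m} ℚ K]
  {A : AbelianVariety ℂ} {ι : 𝓞 K →+* End A} {θ : K →+* Module.End ℂ (complexBetti A.X 1)}

/-- **Shimura §6.2 Thm. 3 + §8.2 Prop. 26 for a type all of whose pattern classes have `n` elements**: a realisation of
`(K; Φ)` is isogenous to a power of a SIMPLE abelian variety realising the primitive sub-pair `(K₁; Φ₁)`, `[K : K₁] = n`,
compatibly with the `𝓞_{K₁}`-actions; `[K : ℚ] = φ(m)`, `dim A = φ(m)/2`, `dim B = [K₁ : ℚ]/2`.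
[cite: Shimura1998, §6.2 Thm. 3 and §8.2 Prop. 26] -/
theorem exists_isogeny_pow_simple_of_ncard (h2 : 2 < m) {n : ℕ} (Φ : CMType K)
    (hn : ∀ s : K →+* ℂ,
      {t : K →+* ℂ | ∀ τ : ℂ ≃+* ℂ, (τ : ℂ →+* ℂ).comp s ∈ Φ.1 ↔ (τ : ℂ →+* ℂ).comp t ∈ Φ.1}.ncard = n)
    (hA : IsCMTypeRealisation Φ A ι θ) :
    Module.finrank ℚ K = Nat.totient m ∧ A.dim = Nat.totient m / 2 ∧
    ∃ (K₁ : IntermediateField ℚ K) (Φ₁ : CMType K₁) (B : AbelianVariety ℂ) (ιB : 𝓞 K₁ →+* End B)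
      (θB : K₁ →+* Module.End ℂ (complexBetti B.X 1)),
      inducedCMType (algebraMap K₁ K) Φ₁ = Φ ∧ Module.finrank K₁ K = n ∧ Module.finrank ℚ K₁ * n = Nat.totient m ∧
      IsCMTypeRealisation Φ₁ B ιB θB ∧ B.IsSimple ∧ B.dim = Module.finrank ℚ K₁ / 2 ∧
      ∃ (h : ℕ) (P : AbelianVariety ℂ) (π : Fin h → (P ⟶ B)),
        Nonempty (IsLimit (Fan.mk P π)) ∧
        ∃ g : A ⟶ P, AbelianVariety.IsIsogeny g ∧
          ∀ (i : Fin h) (a : 𝓞 K₁), ι (RingOfIntegers.mapRingHom (algebraMap K₁ K : K₁ →+* K) a) ≫ (g ≫ π i) =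
            (g ≫ π i) ≫ ιB a := by
  obtain ⟨s⟩ := (inferInstance : Nonempty (K →+* ℂ))
  have hK : Module.finrank ℚ K = Nat.totient m :=
    IsCyclotomicExtension.finrank (K := ℚ) (n := m) K
      (Polynomial.cyclotomic.irreducible_rat (Nat.pos_of_ne_zero (NeZero.ne m)))
  have hdimA : A.dim = Nat.totient m / 2 := by
    have h := Motives.schemeDim_eq_holds hA.1
    rw [hK] at h
    exact h
  refine ⟨hK, hdimA, ?_⟩
  obtain ⟨K₁, Φ₁, h₁, hp₁, hfin⟩ := exists_primitive_inducedCMType_finrank_eq Φ (hn s)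
  haveI : IsCMField K := IsCyclotomicExtension.Rat.isCMField K (S := {m}) ⟨m, rfl, h2⟩
  haveI : IsCMField K₁ := isCMField_of_cmType_intermediateField K₁ Φ₁
  have hA' : IsCMTypeRealisation (inducedCMType (algebraMap K₁ K : K₁ →+* K) Φ₁) A ι θ := by
    rw [h₁]; exact hA
  obtain ⟨B, ιB, θB, hB, h, P, π, hlim, g, hg, hcomm⟩ :=
    Shimura1998_Thm3_isogenousPower_holds K₁ K (algebraMap K₁ K : K₁ →+* K) Φ₁ A ι θ hA'
  have htower := Module.finrank_mul_finrank ℚ K₁ K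
  rw [hfin, hK] at htower
  have hdimB : B.dim = Module.finrank ℚ K₁ / 2 := Motives.schemeDim_eq_holds hB.1
  exact ⟨K₁, Φ₁, B, ιB, θB, h₁, hfin, htower, hB, (isSimple_iff_primitive hB).2 hp₁, hdimB, h, P, π, hlim, g, hg, hcomm⟩

/-- **GGL THM. 3.0 (5) ON VARIETIES (`4 ∣ d`, `d ≥ 8`, `d ∉ {20, 24, 60}`): every realisation `A` of the lower-half type
`(ℚ(ζ_d); Φ_d)` — the CM data of `X_d`, `dim A = φ(d)/2` — is ISOGENOUS TO A POWER `B^h` of a SIMPLE abelian variety `B` with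
complex multiplication by a subfield `K₁ ⊂ ℚ(ζ_d)` of INDEX `2`, `dim B = [K₁ : ℚ]/2 = φ(d)/4`** («`X_d ∼ Y_d²` is isogenous to
the square of a simple abelian variety `Y_d` with complex multiplication by `ℚ(ζ_d − ζ_d^{−1})`»; the identification
`K₁ = ℚ(ζ_d − ζ_d^{−1})`, the exponent `h = 2` and «over `ℚ`» are not typed).  [cite: GalleseGoodsonLombardo2024, §3 Thm. 3.0 (5)
and §3.3] [cite: Shimura1998, §6.2 Thm. 3 and §8.2 Prop. 26] -/
theorem exists_isogeny_pow_simple_of_four_dvd (h4 : 4 ∣ m) (h8 : 8 ≤ m) (h20 : m ≠ 20) (h24 : m ≠ 24) (h60 : m ≠ 60)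
    (Φ : CMType K) (hΦ : ∀ σ : K →+* ℂ, σ ∈ Φ.1 ↔ 2 * (expOf m K σ).val < m) (hA : IsCMTypeRealisation Φ A ι θ) :
    Module.finrank ℚ K = Nat.totient m ∧ A.dim = Nat.totient m / 2 ∧
    ∃ (K₁ : IntermediateField ℚ K) (Φ₁ : CMType K₁) (B : AbelianVariety ℂ) (ιB : 𝓞 K₁ →+* End B)
      (θB : K₁ →+* Module.End ℂ (complexBetti B.X 1)),
      inducedCMType (algebraMap K₁ K) Φ₁ = Φ ∧ Module.finrank K₁ K = 2 ∧ Module.finrank ℚ K₁ * 2 = Nat.totient m ∧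
      IsCMTypeRealisation Φ₁ B ιB θB ∧ B.IsSimple ∧ B.dim = Module.finrank ℚ K₁ / 2 ∧
      ∃ (h : ℕ) (P : AbelianVariety ℂ) (π : Fin h → (P ⟶ B)),
        Nonempty (IsLimit (Fan.mk P π)) ∧
        ∃ g : A ⟶ P, AbelianVariety.IsIsogeny g ∧
          ∀ (i : Fin h) (a : 𝓞 K₁), ι (RingOfIntegers.mapRingHom (algebraMap K₁ K : K₁ →+* K) a) ≫ (g ≫ π i) =
            (g ≫ π i) ≫ ιB a :=
  exists_isogeny_pow_simple_of_ncard (by omega) Φ (ncard_setOf_pattern_half_eq_two h4 h8 h20 h24 h60 Φ hΦ) hA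

/-- **GGL THM. 3.0 (6) ON VARIETIES, `d = 20`: every realisation `A` (`dim A = 4`) of `(ℚ(ζ_{20}); Φ_{20})` is isogenous to a
power of a SIMPLE abelian variety `B` with CM by a subfield of INDEX `4` — an imaginary quadratic field, `dim B = 1`: `X_{20} ∼ Y⁴`
with `Y` a CM ELLIPTIC CURVE** («`X_d ∼ Y_d⁴` is isogenous … to the 4th power of a simple abelian variety»).
[cite: GalleseGoodsonLombardo2024, §3 Thm. 3.0 (6) and §3.4] [cite: Shimura1998, §6.2 Thm. 3 and §8.2 Prop. 26] -/
theorem exists_isogeny_pow_simple_twenty {K : Type} [Field K] [NumberField K] [IsCyclotomicExtension {20} ℚ K]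
    {A : AbelianVariety ℂ} {ι : 𝓞 K →+* End A} {θ : K →+* Module.End ℂ (complexBetti A.X 1)}
    (Φ : CMType K) (hΦ : ∀ σ : K →+* ℂ, σ ∈ Φ.1 ↔ 2 * (expOf 20 K σ).val < 20) (hA : IsCMTypeRealisation Φ A ι θ) :
    A.dim = 4 ∧
    ∃ (K₁ : IntermediateField ℚ K) (Φ₁ : CMType K₁) (B : AbelianVariety ℂ) (ιB : 𝓞 K₁ →+* End B)
      (θB : K₁ →+* Module.End ℂ (complexBetti B.X 1)),
      inducedCMType (algebraMap K₁ K) Φ₁ = Φ ∧ Module.finrank K₁ K = 4 ∧ Module.finrank ℚ K₁ = 2 ∧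
      IsCMTypeRealisation Φ₁ B ιB θB ∧ B.IsSimple ∧ B.dim = 1 ∧
      ∃ (h : ℕ) (P : AbelianVariety ℂ) (π : Fin h → (P ⟶ B)),
        Nonempty (IsLimit (Fan.mk P π)) ∧
        ∃ g : A ⟶ P, AbelianVariety.IsIsogeny g ∧
          ∀ (i : Fin h) (a : 𝓞 K₁), ι (RingOfIntegers.mapRingHom (algebraMap K₁ K : K₁ →+* K) a) ≫ (g ≫ π i) =
            (g ≫ π i) ≫ ιB a := by
  obtain ⟨-, hdimA, K₁, Φ₁, B, ιB, θB, h₁, hfin, hdeg, hB, hBs, hdimB, h, P, π, hlim, g, hg, hcomm⟩ :=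
    exists_isogeny_pow_simple_of_ncard (m := 20) (by norm_num) Φ (ncard_setOf_pattern_half_twenty Φ hΦ) hA
  have htot : Nat.totient 20 = 8 := by decide
  rw [htot] at hdimA hdeg
  have hdeg' : Module.finrank ℚ K₁ = 2 := by omega
  rw [hdeg'] at hdimB
  exact ⟨hdimA, K₁, Φ₁, B, ιB, θB, h₁, hfin, hdeg', hB, hBs, hdimB, h, P, π, hlim, g, hg, hcomm⟩

/-- **GGL THM. 3.0 (6) ON VARIETIES, `d = 24`: every realisation `A` (`dim A = 4`) of `(ℚ(ζ_{24}); Φ_{24})` is isogenous to a power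
of a SIMPLE CM ELLIPTIC CURVE `B` (`[K₁ : ℚ] = 2`, `[ℚ(ζ_{24}) : K₁] = 4`).** [cite: GalleseGoodsonLombardo2024, §3 Thm. 3.0 (6) and §3.4]
[cite: Shimura1998, §6.2 Thm. 3 and §8.2 Prop. 26] -/
theorem exists_isogeny_pow_simple_twentyFour {K : Type} [Field K] [NumberField K] [IsCyclotomicExtension {24} ℚ K]
    {A : AbelianVariety ℂ} {ι : 𝓞 K →+* End A} {θ : K →+* Module.End ℂ (complexBetti A.X 1)}
    (Φ : CMType K) (hΦ : ∀ σ : K →+* ℂ, σ ∈ Φ.1 ↔ 2 * (expOf 24 K σ).val < 24) (hA : IsCMTypeRealisation Φ A ι θ) :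
    A.dim = 4 ∧
    ∃ (K₁ : IntermediateField ℚ K) (Φ₁ : CMType K₁) (B : AbelianVariety ℂ) (ιB : 𝓞 K₁ →+* End B)
      (θB : K₁ →+* Module.End ℂ (complexBetti B.X 1)),
      inducedCMType (algebraMap K₁ K) Φ₁ = Φ ∧ Module.finrank K₁ K = 4 ∧ Module.finrank ℚ K₁ = 2 ∧
      IsCMTypeRealisation Φ₁ B ιB θB ∧ B.IsSimple ∧ B.dim = 1 ∧
      ∃ (h : ℕ) (P : AbelianVariety ℂ) (π : Fin h → (P ⟶ B)),
        Nonempty (IsLimit (Fan.mk P π)) ∧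
        ∃ g : A ⟶ P, AbelianVariety.IsIsogeny g ∧
          ∀ (i : Fin h) (a : 𝓞 K₁), ι (RingOfIntegers.mapRingHom (algebraMap K₁ K : K₁ →+* K) a) ≫ (g ≫ π i) =
            (g ≫ π i) ≫ ιB a := by
  obtain ⟨-, hdimA, K₁, Φ₁, B, ιB, θB, h₁, hfin, hdeg, hB, hBs, hdimB, h, P, π, hlim, g, hg, hcomm⟩ :=
    exists_isogeny_pow_simple_of_ncard (m := 24) (by norm_num) Φ (ncard_setOf_pattern_half_twentyFour Φ hΦ) hA
  have htot : Nat.totient 24 = 8 := by decide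
  rw [htot] at hdimA hdeg
  have hdeg' : Module.finrank ℚ K₁ = 2 := by omega
  rw [hdeg'] at hdimB
  exact ⟨hdimA, K₁, Φ₁, B, ιB, θB, h₁, hfin, hdeg', hB, hBs, hdimB, h, P, π, hlim, g, hg, hcomm⟩

/-- **GGL THM. 3.0 (6) ON VARIETIES, `d = 60`: every realisation `A` (`dim A = 8`) of `(ℚ(ζ_{60}); Φ_{60})` is isogenous to a power
of a SIMPLE abelian SURFACE `B` with CM by a quartic subfield `K₁` of index `4`.** [cite: GalleseGoodsonLombardo2024, §3 Thm. 3.0 (6)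
and §3.4] [cite: Shimura1998, §6.2 Thm. 3 and §8.2 Prop. 26] -/
theorem exists_isogeny_pow_simple_sixty {K : Type} [Field K] [NumberField K] [IsCyclotomicExtension {60} ℚ K]
    {A : AbelianVariety ℂ} {ι : 𝓞 K →+* End A} {θ : K →+* Module.End ℂ (complexBetti A.X 1)}
    (Φ : CMType K) (hΦ : ∀ σ : K →+* ℂ, σ ∈ Φ.1 ↔ 2 * (expOf 60 K σ).val < 60) (hA : IsCMTypeRealisation Φ A ι θ) :
    A.dim = 8 ∧
    ∃ (K₁ : IntermediateField ℚ K) (Φ₁ : CMType K₁) (B : AbelianVariety ℂ) (ιB : 𝓞 K₁ →+* End B)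
      (θB : K₁ →+* Module.End ℂ (complexBetti B.X 1)),
      inducedCMType (algebraMap K₁ K) Φ₁ = Φ ∧ Module.finrank K₁ K = 4 ∧ Module.finrank ℚ K₁ = 4 ∧
      IsCMTypeRealisation Φ₁ B ιB θB ∧ B.IsSimple ∧ B.dim = 2 ∧
      ∃ (h : ℕ) (P : AbelianVariety ℂ) (π : Fin h → (P ⟶ B)),
        Nonempty (IsLimit (Fan.mk P π)) ∧
        ∃ g : A ⟶ P, AbelianVariety.IsIsogeny g ∧
          ∀ (i : Fin h) (a : 𝓞 K₁), ι (RingOfIntegers.mapRingHom (algebraMap K₁ K : K₁ →+* K) a) ≫ (g ≫ π i) =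
            (g ≫ π i) ≫ ιB a := by
  obtain ⟨-, hdimA, K₁, Φ₁, B, ιB, θB, h₁, hfin, hdeg, hB, hBs, hdimB, h, P, π, hlim, g, hg, hcomm⟩ :=
    exists_isogeny_pow_simple_of_ncard (m := 60) (by norm_num) Φ (ncard_setOf_pattern_half_sixty Φ hΦ) hA
  have htot : Nat.totient 60 = 16 := by decide
  rw [htot] at hdimA hdeg
  have hdeg' : Module.finrank ℚ K₁ = 4 := by omega
  rw [hdeg'] at hdimB
  exact ⟨hdimA, K₁, Φ₁, B, ιB, θB, h₁, hfin, hdeg', hB, hBs, hdimB, h, P, π, hlim, g, hg, hcomm⟩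

end Varieties

/-! ## §7 Thm. 3.0 (5) completed: the CM field of `Y_d` is `ℚ(ζ_d − ζ_d^{−1})` = the fixed field of `ζ ↦ −ζ̄`, `[ℚ(ζ_d) : ℚ(ζ_d − ζ_d^{−1})] = 2`,
## and the exponent is `2` (`X_d ∼ Y_d²`); at `20, 24, 60` the exponent is `4` (`X_d ∼ Y_d⁴`) -/

section CMField

open CategoryTheory CategoryTheory.Limits
open NumberField
open Literature.NumberTheory.ComplexMultiplication
open Literature.AlgebraicGeometry.Motives (CMType AbelianVariety)
open Literature.AlgebraicGeometry.HodgeTheory (complexBetti)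
open Literature.AlgebraicGeometry.Pohlmann1968 Literature.AlgebraicGeometry.Pohlmann1968.Cyclotomic
open CyclotomicCMTypeResidueSets

variable {m : ℕ} [NeZero m] {K : Type} [Field K] [NumberField K] [IsCyclotomicExtension {m} ℚ K]

/-- **The residue stabiliser `W` of `Φ_m` is the pair `{1, m/2 − 1}`** (`4 ∣ m ≥ 8`, `m ∉ {20, 24, 60}`), as a Finset of `ℤ/m`.
[cite: GalleseGoodsonLombardo2024, §3.2 Lemma 12] [cite: Gannon1996SU3Revisited, §2 Lemma 5 (a)] -/
theorem stabilizer_half_eq_pair (h4 : 4 ∣ m) (h8 : 8 ≤ m) (h20 : m ≠ 20) (h24 : m ≠ 24) (h60 : m ≠ 60) (Φ : CMType K)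
    (hΦ : ∀ σ : K →+* ℂ, σ ∈ Φ.1 ↔ 2 * (expOf m K σ).val < m) :
    ((unitResidues m).filter fun t => ∀ c ∈ unitResidues m, (c * t ∈ residueSet m Φ ↔ c ∈ residueSet m Φ)) =
      {1, ((m / 2 - 1 : ℕ) : ZMod m)} := by
  classical
  obtain ⟨q, hq⟩ := h4
  have hs := halfSubOne_mem_unitResidues (m := m) (h := m / 2) (by omega) (by omega) (by omega)
  have h1 : (1 : ZMod m) ∈ unitResidues m := by
    rw [← coprime_iff_mem_unitResidues, ZMod.val_one_eq_one_mod, Nat.mod_eq_of_lt (show 1 < m by omega)]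
    exact Nat.coprime_one_left m
  ext v
  rw [Finset.mem_filter, Finset.mem_insert, Finset.mem_singleton]
  constructor
  · rintro ⟨hv, hstab⟩
    exact (forall_mem_residueSet_half_iff_eq_one_or ⟨q, hq⟩ h20 h24 h60 Φ hΦ hv).1 hstab
  · rintro (rfl | rfl)
    · exact ⟨h1, (forall_mem_residueSet_half_iff_eq_one_or ⟨q, hq⟩ h20 h24 h60 Φ hΦ h1).2 (Or.inl rfl)⟩
    · exact ⟨hs, (forall_mem_residueSet_half_iff_eq_one_or ⟨q, hq⟩ h20 h24 h60 Φ hΦ hs).2 (Or.inr rfl)⟩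

/-- `|W| = 2` (`4 ∣ m ≥ 8`, `m ∉ {20, 24, 60}`). [cite: GalleseGoodsonLombardo2024, §3.2 Lemma 12] -/
theorem card_stabilizer_half_eq_two (h4 : 4 ∣ m) (h8 : 8 ≤ m) (h20 : m ≠ 20) (h24 : m ≠ 24) (h60 : m ≠ 60)
    (Φ : CMType K) (hΦ : ∀ σ : K →+* ℂ, σ ∈ Φ.1 ↔ 2 * (expOf m K σ).val < m) :
    ((unitResidues m).filter fun t => ∀ c ∈ unitResidues m, (c * t ∈ residueSet m Φ ↔ c ∈ residueSet m Φ)).card = 2 := by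
  classical
  rw [stabilizer_half_eq_pair h4 h8 h20 h24 h60 Φ hΦ]
  obtain ⟨q, hq⟩ := h4
  refine Finset.card_pair fun h => ?_
  have h2 := congrArg ZMod.val h
  rw [ZMod.val_natCast, ZMod.val_one_eq_one_mod, Nat.mod_eq_of_lt (show m / 2 - 1 < m by omega),
    Nat.mod_eq_of_lt (show 1 < m by omega)] at h2
  omega

/-- **GGL THM. 3.0 (5) ∕ §3.3, THE CM FIELD OF `Y_d`: «the subfield of `ℚ(ζ_m)` fixed by `{1, m/2 − 1}` … which is `ℚ(ζ_m − ζ_m^{−1})`».**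
For `4 ∣ m ≥ 8`, `m ∉ {20, 24, 60}`, the lower-half type `Φ` of `K = ℚ(ζ_m)` and ANY primitive sub-pair `(K₁, Φ₁)` inducing `Φ` (the
CM field and type of the simple factor `Y_m`, §§5–6): there is `σ ∈ Gal(K/ℚ)` with `σ(ζ) = ζ^{m/2 − 1} = −ζ⁻¹` (`= −ζ̄` in ℂ), `σ² = 1`,
`K₁ = {x | σx = x}`, `ζ ∉ K₁`, `δ := ζ − ζ⁻¹ ∈ K₁`, `[K : K₁] = 2`, `2[K₁ : ℚ] = φ(m)` and **`K₁ = ℚ(δ) = ℚ(ζ_m − ζ_m^{−1})`**.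
PROOF as in the tree's 2-power precedent `HyperellipticJacobianTwoPower.eq_fixedField_and_eq_adjoin_of_primitive` (Emory–Goodson Prop.
3.2): the residue stabiliser is `{1, m/2 − 1}` (`stabilizer_half_eq_pair`), the fixed-field dictionary (Koblitz–Rohrlich p. 1184;
`mem_iff_apply_eq_of_primitive_of_forall_exists_pow`, `zetaOf_not_mem_of_primitive`, `finrank_eq_card_filter_of_primitive`) gives
`K₁ = K^σ` of index `2`, `δ = ζ + σζ` is fixed, and `ζ` is a root of `X² − δX − 1 ∈ ℚ(δ)[X]`.
[cite: GalleseGoodsonLombardo2024, §3 Thm. 3.0 (5) and §3.3] [cite: Shimura1998, §8.2 Prop. 26 (proof)] [cite: KoblitzRohrlich1978, §1 (p. 1184)] -/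
theorem eq_fixedField_and_eq_adjoin_of_primitive_of_four_dvd (h4 : 4 ∣ m) (h8 : 8 ≤ m) (h20 : m ≠ 20) (h24 : m ≠ 24)
    (h60 : m ≠ 60) (Φ : CMType K) (hΦ : ∀ σ : K →+* ℂ, σ ∈ Φ.1 ↔ 2 * (expOf m K σ).val < m)
    {K₁ : IntermediateField ℚ K} (Φ₁ : CMType K₁) (h₁ : inducedCMType (algebraMap K₁ K) Φ₁ = Φ)
    (hp₁ : ∀ s t : K₁ →+* ℂ,
      (∀ τ : ℂ ≃+* ℂ, (τ : ℂ →+* ℂ).comp s ∈ Φ₁.1 ↔ (τ : ℂ →+* ℂ).comp t ∈ Φ₁.1) → s = t) :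
    ∃ σ : K ≃ₐ[ℚ] K, σ (zetaOf m K) = -(zetaOf m K)⁻¹ ∧ σ ^ 2 = 1 ∧ (∀ x : K, x ∈ K₁ ↔ σ x = x) ∧
      zetaOf m K ∉ K₁ ∧ zetaOf m K - (zetaOf m K)⁻¹ ∈ K₁ ∧ Module.finrank K₁ K = 2 ∧
      2 * Module.finrank ℚ K₁ = Nat.totient m ∧ K₁ = IntermediateField.adjoin ℚ {zetaOf m K - (zetaOf m K)⁻¹} := by
  classical
  obtain ⟨q, hq⟩ := h4
  obtain ⟨e, he⟩ : ∃ e, m = 4 * e := ⟨q, hq⟩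
  set n : ℕ := m / 2 with hn
  have hd2n : m = 2 * n := by omega
  have hn4 : 4 ≤ n := by omega
  set u : ZMod m := ((m / 2 - 1 : ℕ) : ZMod m) with hu
  have huval : u.val = n - 1 := by rw [hu, ZMod.val_natCast_of_lt (by omega)]
  -- `u` lies in the stabiliser `W = {1, u}`
  have hWeq := stabilizer_half_eq_pair ⟨q, hq⟩ h8 h20 h24 h60 Φ hΦ
  have huW : u ∈ ((unitResidues m).filter fun t =>
      ∀ c ∈ unitResidues m, (c * t ∈ residueSet m Φ ↔ c ∈ residueSet m Φ)) := by
    rw [hWeq]; simp [hu]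
  have hu_unit : u ∈ unitResidues m := (Finset.mem_filter.1 huW).1
  have hu1 : u ≠ 1 := fun h => by
    have : u.val = 1 := by rw [h, ZMod.val_one_eq_one_mod, Nat.mod_eq_of_lt (by omega)]
    rw [huval] at this
    omega
  -- the automorphism `σ` with `a(σ) = u`
  obtain ⟨σ, hσ⟩ := exists_autResidue_eq m (L := K) u hu_unit
  have hW : ∀ t ∈ ((unitResidues m).filter fun t => ∀ c ∈ unitResidues m, (c * t ∈ residueSet m Φ ↔ c ∈ residueSet m Φ)),
      ∃ k : ℕ, t = autResidue m K σ ^ k := fun t ht => by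
    rw [hWeq, Finset.mem_insert, Finset.mem_singleton] at ht
    rcases ht with rfl | rfl
    · exact ⟨0, by rw [pow_zero]⟩
    · exact ⟨1, by rw [pow_one, hσ]⟩
  have hK : ∀ x : K, x ∈ K₁ ↔ σ x = x :=
    mem_iff_apply_eq_of_primitive_of_forall_exists_pow (N := m) Φ Φ₁ h₁ hp₁ (hσ.symm ▸ huW) hW
  -- `σ(ζ) = ζ^{n−1} = −ζ⁻¹` since `ζⁿ = −1`
  have hζ : IsPrimitiveRoot (zetaOf m K) m := IsCyclotomicExtension.zeta_spec m ℚ K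
  have hζ0 : zetaOf m K ≠ 0 := hζ.ne_zero (NeZero.ne m)
  have hζn : zetaOf m K ^ n = -1 :=
    (hζ.pow (Nat.pos_of_ne_zero (NeZero.ne m)) (by rw [hd2n, mul_comm])).eq_neg_one_of_two_right
  have hσζ : σ (zetaOf m K) = -(zetaOf m K)⁻¹ := by
    rw [autResidue_spec m σ, hσ, huval]
    have h1 : zetaOf m K ^ (n - 1) * zetaOf m K = -1 := by
      rw [← pow_succ, show n - 1 + 1 = n from by omega, hζn]
    field_simp
    linear_combination h1
  -- `σ² = 1` (`u² = 1`: `(n−1)² = m(e−1) + 1`, `n = 2e`)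
  have hu2 : u ^ 2 = 1 := by
    have hne : n = 2 * e := by omega
    have he1 : 1 ≤ e := by omega
    have hsq : (n - 1) ^ 2 = m * (e - 1) + 1 := by
      rw [hd2n, hne]
      obtain ⟨e', rfl⟩ : ∃ e', e = e' + 1 := ⟨e - 1, by omega⟩
      rw [show 2 * (e' + 1) - 1 = 2 * e' + 1 from by omega, show e' + 1 - 1 = e' from by omega]
      ring
    rw [show u = ((n - 1 : ℕ) : ZMod m) by rw [hu, hn], ← Nat.cast_pow, hsq, Nat.cast_add, Nat.cast_mul, ZMod.natCast_self,
      zero_mul, zero_add, Nat.cast_one]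
  have hσ2 : σ ^ 2 = 1 := (autResidue_eq_one_iff (N := m) _).1 (by rw [autResidue_pow, hσ, hu2])
  -- `δ = ζ − ζ⁻¹` is fixed by `σ`
  set δ : K := zetaOf m K - (zetaOf m K)⁻¹ with hδ
  have hσδ : σ δ = δ := by
    rw [hδ, map_sub, map_inv₀, hσζ, inv_neg, inv_inv]
    ring
  have hδK : δ ∈ K₁ := (hK δ).2 hσδ
  -- `ζ ∉ K₁`, `[K : K₁] = |W| = 2`, `2[K₁ : ℚ] = φ(m)`
  have hζK : zetaOf m K ∉ K₁ := zetaOf_not_mem_of_primitive (N := m) Φ Φ₁ h₁ hp₁ huW hu1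
  have hK2 : Module.finrank K₁ K = 2 := by
    rw [finrank_eq_card_filter_of_primitive (N := m) Φ Φ₁ h₁ hp₁, card_stabilizer_half_eq_two ⟨q, hq⟩ h8 h20 h24 h60 Φ hΦ]
  have hdegK : Module.finrank ℚ K = Nat.totient m :=
    IsCyclotomicExtension.finrank (K := ℚ) (n := m) K
      (Polynomial.cyclotomic.irreducible_rat (Nat.pos_of_ne_zero (NeZero.ne m)))
  have hdeg₁ : 2 * Module.finrank ℚ K₁ = Nat.totient m := by
    have htower := Module.finrank_mul_finrank ℚ K₁ K
    rw [hK2, hdegK] at htower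
    omega
  -- `K₁ = ℚ(δ)`: `ζ` is a root of `X² − δX − 1` over `ℚ(δ) ⊆ K₁`
  set M : IntermediateField ℚ K := IntermediateField.adjoin ℚ {δ} with hM
  have hle : M ≤ K₁ := IntermediateField.adjoin_simple_le_iff.2 hδK
  have htopM : IntermediateField.adjoin M {zetaOf m K} = ⊤ := by
    apply IntermediateField.adjoin_eq_top_of_algebra
    rw [eq_top_iff]
    intro x _
    have hx : x ∈ Algebra.adjoin ℚ {zetaOf m K} := by
      rw [IsCyclotomicExtension.adjoin_primitive_root_eq_top hζ]; trivial
    have hle' : Algebra.adjoin ℚ {zetaOf m K} ≤ (Algebra.adjoin M {zetaOf m K}).restrictScalars ℚ :=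
      Algebra.adjoin_le Algebra.subset_adjoin
    exact hle' hx
  set δ' : M := ⟨δ, IntermediateField.mem_adjoin_simple_self ℚ δ⟩ with hδ'
  set p : Polynomial M := Polynomial.X ^ 2 - Polynomial.C δ' * Polynomial.X - 1 with hp
  have hp0 : p ≠ 0 := by
    intro h0
    have := congrArg (fun q : Polynomial M => q.coeff 2) h0
    simp [hp, Polynomial.coeff_one] at this
  have hpdeg : p.degree ≤ 2 := by
    rw [hp]
    compute_degree!
  have haeval : Polynomial.aeval (zetaOf m K) p = 0 := by
    have hδval : algebraMap M K δ' = δ := rfl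
    simp only [hp, map_sub, map_mul, map_pow, Polynomial.aeval_X, Polynomial.aeval_C, map_one, hδval, hδ]
    field_simp
    ring
  have hint : IsIntegral M (zetaOf m K) := IsIntegral.of_finite M (zetaOf m K)
  have hfinM : Module.finrank M K ≤ 2 := by
    rw [← IntermediateField.finrank_top', ← htopM, IntermediateField.adjoin.finrank hint]
    exact Polynomial.natDegree_le_iff_degree_le.2 ((minpoly.degree_le_of_ne_zero M _ hp0 haeval).trans hpdeg)
  have hMK : M = K₁ := IntermediateField.eq_of_le_of_finrank_le' hle (by rw [hK2]; exact hfinM)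
  exact ⟨σ, hσζ, hσ2, hK, hζK, hδK, hK2, hdeg₁, hMK.symm⟩

variable {A : AbelianVariety ℂ} {ι : 𝓞 K →+* End A} {θ : K →+* Module.End ℂ (complexBetti A.X 1)}

/-- Re-indexing an existential over `Fin w` along `w = k`. [folklore] -/
private theorem exists_fan_of_eq {B P : AbelianVariety ℂ} {k w : ℕ} (hw : w = k) (π : Fin w → (P ⟶ B))
    (hl : Nonempty (IsLimit (Fan.mk P π))) {K₁ : IntermediateField ℚ K} {ιB : 𝓞 K₁ →+* End B}
    (hc : ∃ g : A ⟶ P, AbelianVariety.IsIsogeny g ∧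
      ∀ (j : Fin w) (a : 𝓞 K₁), ι (RingOfIntegers.mapRingHom (algebraMap K₁ K : K₁ →+* K) a) ≫ (g ≫ π j) =
        (g ≫ π j) ≫ ιB a) :
    ∃ (π' : Fin k → (P ⟶ B)), Nonempty (IsLimit (Fan.mk P π')) ∧
      ∃ g : A ⟶ P, AbelianVariety.IsIsogeny g ∧
        ∀ (j : Fin k) (a : 𝓞 K₁), ι (RingOfIntegers.mapRingHom (algebraMap K₁ K : K₁ →+* K) a) ≫ (g ≫ π' j) =
          (g ≫ π' j) ≫ ιB a := by
  subst hw
  exact ⟨π, hl, hc⟩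

/-- **GGL THM. 3.0 (5) WITH THE EXPONENT AND THE CM FIELD: `X_d ∼ Y_d × Y_d`, `Y_d` SIMPLE with complex multiplication by
`ℚ(ζ_d − ζ_d^{−1})`** (`4 ∣ d ≥ 8`, `d ∉ {20, 24, 60}`).  For ANY realisation `A` of the lower-half type `(ℚ(ζ_d); Φ_d)`: the primitive
sub-pair `(K₁, Φ₁)` with `K₁ = ℚ(ζ_d − ζ_d^{−1})`, `[ℚ(ζ_d) : K₁] = 2`, a SIMPLE `B ⊨ (K₁; Φ₁)` with `4·dim B = φ(d)` (`= 2·dim A`), a product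
`P` of TWO copies of `B` (a limit fan) and an `𝓞_{K₁}`-equivariant ISOGENY `A → P` (Koblitz–Rohrlich ∕ Shimura–Taniyama in the tree's
`exists_isIsogeny_power_simple_cyclotomic`, exponent `|W| = 2` by `card_stabilizer_half_eq_two`).  «over `ℚ`» ∕ «over `ℚ(ζ_d)`» are not typed.
[cite: GalleseGoodsonLombardo2024, §3 Thm. 3.0 (5) and §3.3] [cite: Shimura1998, §6.2 Thm. 3 and §8.2 Prop. 26] [cite: KoblitzRohrlich1978, §1 (p. 1184)] -/
theorem exists_isogeny_sq_simple_of_four_dvd (h4 : 4 ∣ m) (h8 : 8 ≤ m) (h20 : m ≠ 20) (h24 : m ≠ 24) (h60 : m ≠ 60)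
    (Φ : CMType K) (hΦ : ∀ σ : K →+* ℂ, σ ∈ Φ.1 ↔ 2 * (expOf m K σ).val < m) (hA : IsCMTypeRealisation Φ A ι θ) :
    A.dim = Nat.totient m / 2 ∧
    ∃ (K₁ : IntermediateField ℚ K) (Φ₁ : CMType K₁) (B : AbelianVariety ℂ) (ιB : 𝓞 K₁ →+* End B)
      (θB : K₁ →+* Module.End ℂ (complexBetti B.X 1)),
      IsCMField K₁ ∧ inducedCMType (algebraMap K₁ K) Φ₁ = Φ ∧ Module.finrank K₁ K = 2 ∧
      K₁ = IntermediateField.adjoin ℚ {zetaOf m K - (zetaOf m K)⁻¹} ∧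
      IsCMTypeRealisation Φ₁ B ιB θB ∧ B.IsSimple ∧ 4 * B.dim = Nat.totient m ∧
      ∃ (P : AbelianVariety ℂ) (π : Fin 2 → (P ⟶ B)),
        Nonempty (IsLimit (Fan.mk P π)) ∧
        ∃ g : A ⟶ P, AbelianVariety.IsIsogeny g ∧
          ∀ (j : Fin 2) (a : 𝓞 K₁), ι (RingOfIntegers.mapRingHom (algebraMap K₁ K : K₁ →+* K) a) ≫ (g ≫ π j) =
            (g ≫ π j) ≫ ιB a := by
  haveI : IsCMField K := IsCyclotomicExtension.Rat.isCMField K (S := {m}) ⟨m, rfl, by omega⟩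
  have hdegK : Module.finrank ℚ K = Nat.totient m :=
    IsCyclotomicExtension.finrank (K := ℚ) (n := m) K
      (Polynomial.cyclotomic.irreducible_rat (Nat.pos_of_ne_zero (NeZero.ne m)))
  have hdimA : A.dim = Nat.totient m / 2 := by
    have h := Motives.schemeDim_eq_holds hA.1
    rw [hdegK] at h
    exact h
  refine ⟨hdimA, ?_⟩
  have hW := card_stabilizer_half_eq_two h4 h8 h20 h24 h60 Φ hΦ
  obtain ⟨K₁, Φ₁, hCM, h₁, hp₁, hfin, B, ιB, θB, hB, hs, hdimB, P, π, hP, hg⟩ :=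
    exists_isIsogeny_power_simple_cyclotomic (N := m) hA
  rw [hW] at hfin hdimB
  obtain ⟨-, -, -, -, -, -, -, -, hK₁⟩ := eq_fixedField_and_eq_adjoin_of_primitive_of_four_dvd h4 h8 h20 h24 h60 Φ hΦ Φ₁ h₁ hp₁
  obtain ⟨π', hP', g, hg', hcomm⟩ := exists_fan_of_eq (ι := ι) hW π hP hg
  exact ⟨K₁, Φ₁, B, ιB, θB, hCM, h₁, hfin, hK₁, hB, hs, by omega, P, π', hP', g, hg', hcomm⟩

/-- **GGL THM. 3.0 (6) WITH THE EXPONENT, `d = 20`: `X_{20} ∼ Y⁴` with `Y` a SIMPLE CM ELLIPTIC CURVE** — every realisation `A`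
(`dim A = 4`) of `(ℚ(ζ_{20}); Φ_{20})` is `𝓞_{K₁}`-equivariantly isogenous to a product of FOUR copies of a simple `B` of dimension `1`
realising the primitive sub-pair (`[ℚ(ζ_{20}) : K₁] = |W| = 4`). [cite: GalleseGoodsonLombardo2024, §3 Thm. 3.0 (6) and Lemma 12]
[cite: Shimura1998, §6.2 Thm. 3 and §8.2 Prop. 26] [cite: KoblitzRohrlich1978, §1 (p. 1184)] -/
theorem exists_isogeny_pow_four_simple_twenty {K : Type} [Field K] [NumberField K] [IsCyclotomicExtension {20} ℚ K]
    {A : AbelianVariety ℂ} {ι : 𝓞 K →+* End A} {θ : K →+* Module.End ℂ (complexBetti A.X 1)}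
    (Φ : CMType K) (hΦ : ∀ σ : K →+* ℂ, σ ∈ Φ.1 ↔ 2 * (expOf 20 K σ).val < 20) (hA : IsCMTypeRealisation Φ A ι θ) :
    ∃ (K₁ : IntermediateField ℚ K) (Φ₁ : CMType K₁) (B : AbelianVariety ℂ) (ιB : 𝓞 K₁ →+* End B)
      (θB : K₁ →+* Module.End ℂ (complexBetti B.X 1)),
      IsCMField K₁ ∧ inducedCMType (algebraMap K₁ K) Φ₁ = Φ ∧ Module.finrank K₁ K = 4 ∧
      IsCMTypeRealisation Φ₁ B ιB θB ∧ B.IsSimple ∧ B.dim = 1 ∧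
      ∃ (P : AbelianVariety ℂ) (π : Fin 4 → (P ⟶ B)),
        Nonempty (IsLimit (Fan.mk P π)) ∧
        ∃ g : A ⟶ P, AbelianVariety.IsIsogeny g ∧
          ∀ (j : Fin 4) (a : 𝓞 K₁), ι (RingOfIntegers.mapRingHom (algebraMap K₁ K : K₁ →+* K) a) ≫ (g ≫ π j) =
            (g ≫ π j) ≫ ιB a := by
  classical
  haveI : IsCMField K := IsCyclotomicExtension.Rat.isCMField K (S := {20}) ⟨20, rfl, by norm_num⟩
  have hW : ((unitResidues 20).filter fun t =>
      ∀ c ∈ unitResidues 20, (c * t ∈ residueSet 20 Φ ↔ c ∈ residueSet 20 Φ)).card = 4 := by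
    rw [Finset.filter_congr fun t ht => forall_mem_residueSet_half_iff Φ hΦ ht, stabilizer_half_twenty]; decide
  obtain ⟨K₁, Φ₁, hCM, h₁, hp₁, hfin, B, ιB, θB, hB, hs, hdimB, P, π, hP, hg⟩ :=
    exists_isIsogeny_power_simple_cyclotomic (N := 20) hA
  rw [hW] at hfin hdimB
  have htot : Nat.totient 20 = 8 := by decide
  obtain ⟨π', hP', g, hg', hcomm⟩ := exists_fan_of_eq (ι := ι) hW π hP hg
  exact ⟨K₁, Φ₁, B, ιB, θB, hCM, h₁, hfin, hB, hs, by omega, P, π', hP', g, hg', hcomm⟩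

/-- **GGL THM. 3.0 (6) WITH THE EXPONENT, `d = 24`: `X_{24} ∼ Y⁴` with `Y` a SIMPLE CM ELLIPTIC CURVE.**
[cite: GalleseGoodsonLombardo2024, §3 Thm. 3.0 (6) and Lemma 12] [cite: Shimura1998, §6.2 Thm. 3 and §8.2 Prop. 26]
[cite: KoblitzRohrlich1978, §1 (p. 1184)] -/
theorem exists_isogeny_pow_four_simple_twentyFour {K : Type} [Field K] [NumberField K] [IsCyclotomicExtension {24} ℚ K]
    {A : AbelianVariety ℂ} {ι : 𝓞 K →+* End A} {θ : K →+* Module.End ℂ (complexBetti A.X 1)}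
    (Φ : CMType K) (hΦ : ∀ σ : K →+* ℂ, σ ∈ Φ.1 ↔ 2 * (expOf 24 K σ).val < 24) (hA : IsCMTypeRealisation Φ A ι θ) :
    ∃ (K₁ : IntermediateField ℚ K) (Φ₁ : CMType K₁) (B : AbelianVariety ℂ) (ιB : 𝓞 K₁ →+* End B)
      (θB : K₁ →+* Module.End ℂ (complexBetti B.X 1)),
      IsCMField K₁ ∧ inducedCMType (algebraMap K₁ K) Φ₁ = Φ ∧ Module.finrank K₁ K = 4 ∧
      IsCMTypeRealisation Φ₁ B ιB θB ∧ B.IsSimple ∧ B.dim = 1 ∧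
      ∃ (P : AbelianVariety ℂ) (π : Fin 4 → (P ⟶ B)),
        Nonempty (IsLimit (Fan.mk P π)) ∧
        ∃ g : A ⟶ P, AbelianVariety.IsIsogeny g ∧
          ∀ (j : Fin 4) (a : 𝓞 K₁), ι (RingOfIntegers.mapRingHom (algebraMap K₁ K : K₁ →+* K) a) ≫ (g ≫ π j) =
            (g ≫ π j) ≫ ιB a := by
  classical
  haveI : IsCMField K := IsCyclotomicExtension.Rat.isCMField K (S := {24}) ⟨24, rfl, by norm_num⟩
  have hW : ((unitResidues 24).filter fun t =>
      ∀ c ∈ unitResidues 24, (c * t ∈ residueSet 24 Φ ↔ c ∈ residueSet 24 Φ)).card = 4 := by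
    rw [Finset.filter_congr fun t ht => forall_mem_residueSet_half_iff Φ hΦ ht, stabilizer_half_twentyFour]; decide
  obtain ⟨K₁, Φ₁, hCM, h₁, hp₁, hfin, B, ιB, θB, hB, hs, hdimB, P, π, hP, hg⟩ :=
    exists_isIsogeny_power_simple_cyclotomic (N := 24) hA
  rw [hW] at hfin hdimB
  have htot : Nat.totient 24 = 8 := by decide
  obtain ⟨π', hP', g, hg', hcomm⟩ := exists_fan_of_eq (ι := ι) hW π hP hg
  exact ⟨K₁, Φ₁, B, ιB, θB, hCM, h₁, hfin, hB, hs, by omega, P, π', hP', g, hg', hcomm⟩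

/-- **GGL THM. 3.0 (6) WITH THE EXPONENT, `d = 60`: `X_{60} ∼ Y⁴` with `Y` a SIMPLE CM abelian SURFACE.**
[cite: GalleseGoodsonLombardo2024, §3 Thm. 3.0 (6) and Lemma 12] [cite: Shimura1998, §6.2 Thm. 3 and §8.2 Prop. 26]
[cite: KoblitzRohrlich1978, §1 (p. 1184)] -/
theorem exists_isogeny_pow_four_simple_sixty {K : Type} [Field K] [NumberField K] [IsCyclotomicExtension {60} ℚ K]
    {A : AbelianVariety ℂ} {ι : 𝓞 K →+* End A} {θ : K →+* Module.End ℂ (complexBetti A.X 1)}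
    (Φ : CMType K) (hΦ : ∀ σ : K →+* ℂ, σ ∈ Φ.1 ↔ 2 * (expOf 60 K σ).val < 60) (hA : IsCMTypeRealisation Φ A ι θ) :
    ∃ (K₁ : IntermediateField ℚ K) (Φ₁ : CMType K₁) (B : AbelianVariety ℂ) (ιB : 𝓞 K₁ →+* End B)
      (θB : K₁ →+* Module.End ℂ (complexBetti B.X 1)),
      IsCMField K₁ ∧ inducedCMType (algebraMap K₁ K) Φ₁ = Φ ∧ Module.finrank K₁ K = 4 ∧
      IsCMTypeRealisation Φ₁ B ιB θB ∧ B.IsSimple ∧ B.dim = 2 ∧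
      ∃ (P : AbelianVariety ℂ) (π : Fin 4 → (P ⟶ B)),
        Nonempty (IsLimit (Fan.mk P π)) ∧
        ∃ g : A ⟶ P, AbelianVariety.IsIsogeny g ∧
          ∀ (j : Fin 4) (a : 𝓞 K₁), ι (RingOfIntegers.mapRingHom (algebraMap K₁ K : K₁ →+* K) a) ≫ (g ≫ π j) =
            (g ≫ π j) ≫ ιB a := by
  classical
  haveI : IsCMField K := IsCyclotomicExtension.Rat.isCMField K (S := {60}) ⟨60, rfl, by norm_num⟩
  have hW : ((unitResidues 60).filter fun t =>
      ∀ c ∈ unitResidues 60, (c * t ∈ residueSet 60 Φ ↔ c ∈ residueSet 60 Φ)).card = 4 := by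
    rw [Finset.filter_congr fun t ht => forall_mem_residueSet_half_iff Φ hΦ ht, stabilizer_half_sixty]; decide
  obtain ⟨K₁, Φ₁, hCM, h₁, hp₁, hfin, B, ιB, θB, hB, hs, hdimB, P, π, hP, hg⟩ :=
    exists_isIsogeny_power_simple_cyclotomic (N := 60) hA
  rw [hW] at hfin hdimB
  have htot : Nat.totient 60 = 16 := by decide
  obtain ⟨π', hP', g, hg', hcomm⟩ := exists_fan_of_eq (ι := ι) hW π hP hg
  exact ⟨K₁, Φ₁, B, ιB, θB, hCM, h₁, hfin, hB, hs, by omega, P, π', hP', g, hg', hcomm⟩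

end CMField

/-! ## §8 The exceptional CM fields (§3.4): `F_{20} = ℚ(√−5)`, `F_{24} = ℚ(√−6)`, `F_{60} = ℚ(root of x⁴ + 15x² + 45)` — the primitive
## subfield is generated by the period `r = Σ_{h ∈ W} ζ^h` of the stabiliser -/

section ExceptionalFields

open NumberField
open Literature.NumberTheory.ComplexMultiplication
open Literature.AlgebraicGeometry.Motives (CMType)
open Literature.AlgebraicGeometry.Pohlmann1968 Literature.AlgebraicGeometry.Pohlmann1968.Cyclotomic
open CyclotomicCMTypeResidueSets

variable {K : Type} [Field K] [NumberField K]

omit [NumberField K] in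
/-- Powers of a root of unity reduce modulo its order. [folklore] -/
private theorem pow_eq_pow_mod {ζ : K} {m : ℕ} (h : ζ ^ m = 1) (n : ℕ) : ζ ^ n = ζ ^ (n % m) := by
  conv_lhs => rw [← Nat.div_add_mod n m, pow_add, pow_mul, h, one_pow, one_mul]

/-- `[K : M] ≤ 4` when `ζ` generates `K` and is killed by a monic quartic over `M`. [folklore] -/
private theorem finrank_le_four_of_quartic {m : ℕ} [NeZero m] [IsCyclotomicExtension {m} ℚ K] (M : IntermediateField ℚ K)
    (p : Polynomial M) (hp4 : p.coeff 4 = 1) (hpdeg : p.degree ≤ 4) (haeval : Polynomial.aeval (zetaOf m K) p = 0) :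
    Module.finrank M K ≤ 4 := by
  have hζ : IsPrimitiveRoot (zetaOf m K) m := IsCyclotomicExtension.zeta_spec m ℚ K
  have htopM : IntermediateField.adjoin M {zetaOf m K} = ⊤ := by
    apply IntermediateField.adjoin_eq_top_of_algebra
    rw [eq_top_iff]
    intro x _
    have hx : x ∈ Algebra.adjoin ℚ {zetaOf m K} := by
      rw [IsCyclotomicExtension.adjoin_primitive_root_eq_top hζ]; trivial
    have hle' : Algebra.adjoin ℚ {zetaOf m K} ≤ (Algebra.adjoin M {zetaOf m K}).restrictScalars ℚ :=
      Algebra.adjoin_le Algebra.subset_adjoin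
    exact hle' hx
  have hp0 : p ≠ 0 := by
    intro h0
    rw [h0, Polynomial.coeff_zero] at hp4
    exact zero_ne_one hp4
  have hint : IsIntegral M (zetaOf m K) := IsIntegral.of_finite M (zetaOf m K)
  rw [← IntermediateField.finrank_top', ← htopM, IntermediateField.adjoin.finrank hint]
  exact Polynomial.natDegree_le_iff_degree_le.2 ((minpoly.degree_le_of_ne_zero M _ hp0 haeval).trans hpdeg)

/-- **GGL §3.4, `d = 20`: «ℚ(√−5) is the subfield of ℚ(ζ_{20}) fixed by the subgroup {1,3,7,9} of (ℤ/20ℤ)ˣ» — THE CM FIELD OF `Y_{20}`.**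
For the lower-half type `Φ` of `K = ℚ(ζ_{20})` and ANY primitive sub-pair `(K₁, Φ₁)`: the period `r = ζ + ζ³ + ζ⁷ + ζ⁹` of the
stabiliser `W = {1, 3, 7, 9}` satisfies `r² = −5`, lies in `K₁`, `[K : K₁] = 4`, `[K₁ : ℚ] = 2`, and `K₁ = ℚ(r) = ℚ(√−5)` (`ζ` is a root of
`X⁴ − rX³ − 3X² + rX + 1 ∈ ℚ(r)[X]`). [cite: GalleseGoodsonLombardo2024, §3.4 and Lemma 14 (`F_{20} = ℚ(√−5)`)]
[cite: KoblitzRohrlich1978, §1 (p. 1184)] -/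
theorem primitiveSubfield_twenty [IsCyclotomicExtension {20} ℚ K] (Φ : CMType K)
    (hΦ : ∀ σ : K →+* ℂ, σ ∈ Φ.1 ↔ 2 * (expOf 20 K σ).val < 20) {K₁ : IntermediateField ℚ K} (Φ₁ : CMType K₁)
    (h₁ : inducedCMType (algebraMap K₁ K) Φ₁ = Φ)
    (hp₁ : ∀ s t : K₁ →+* ℂ,
      (∀ τ : ℂ ≃+* ℂ, (τ : ℂ →+* ℂ).comp s ∈ Φ₁.1 ↔ (τ : ℂ →+* ℂ).comp t ∈ Φ₁.1) → s = t) :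
    (zetaOf 20 K + zetaOf 20 K ^ 3 + zetaOf 20 K ^ 7 + zetaOf 20 K ^ 9) ^ 2 = -5 ∧
    zetaOf 20 K + zetaOf 20 K ^ 3 + zetaOf 20 K ^ 7 + zetaOf 20 K ^ 9 ∈ K₁ ∧
    Module.finrank K₁ K = 4 ∧ Module.finrank ℚ K₁ = 2 ∧
    K₁ = IntermediateField.adjoin ℚ {zetaOf 20 K + zetaOf 20 K ^ 3 + zetaOf 20 K ^ 7 + zetaOf 20 K ^ 9} := by
  classical
  set ζ := zetaOf 20 K with hζdef
  have hζ : IsPrimitiveRoot ζ 20 := IsCyclotomicExtension.zeta_spec 20 ℚ K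
  have h20 : ζ ^ 20 = 1 := hζ.pow_eq_one
  have h10 : ζ ^ 10 = -1 := (hζ.pow (by norm_num) (show 20 = 10 * 2 by norm_num)).eq_neg_one_of_two_right
  have h5 : 1 + ζ ^ 4 + ζ ^ 8 + ζ ^ 12 + ζ ^ 16 = 0 := by
    have h := (hζ.pow (by norm_num) (show 20 = 4 * 5 by norm_num)).geom_sum_eq_zero (by norm_num : 1 < 5)
    simp only [Finset.sum_range_succ, Finset.sum_range_zero, ← pow_mul, zero_add] at h
    norm_num at h
    linear_combination h
  set r := ζ + ζ ^ 3 + ζ ^ 7 + ζ ^ 9 with hr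
  have hr2 : r ^ 2 = -5 := by
    rw [hr]
    linear_combination (-5 * ζ ^ 2 - 6 * ζ ^ 4 - 8 * ζ ^ 6 - 9 * ζ ^ 8 - 6 * ζ ^ 10 - 4 * ζ ^ 12 - 3 * ζ ^ 14 - ζ ^ 16) * h10
      + (5 + 6 * ζ ^ 2 + 3 * ζ ^ 4 + 3 * ζ ^ 6 + 3 * ζ ^ 8 + ζ ^ 10) * h5
  -- the stabiliser `W = {1, 3, 7, 9}`
  have hW : ((unitResidues 20).filter fun t =>
      ∀ c ∈ unitResidues 20, (c * t ∈ residueSet 20 Φ ↔ c ∈ residueSet 20 Φ)) = {1, 3, 7, 9} := by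
    rw [Finset.filter_congr fun t ht => forall_mem_residueSet_half_iff Φ hΦ ht, stabilizer_half_twenty]
  -- `r ∈ K₁`: `r` is fixed by every `γ` with `a(γ) ∈ W`
  have hrK : r ∈ K₁ := by
    refine (mem_iff_forall_autResidue_mem_of_primitive (N := 20) Φ Φ₁ h₁ hp₁ r).2 fun γ hγ => ?_
    rw [hW] at hγ
    simp only [Finset.mem_insert, Finset.mem_singleton] at hγ
    have hγζ : γ ζ = ζ ^ (autResidue 20 K γ).val := autResidue_spec 20 γ
    have hγr : γ r = γ ζ + γ ζ ^ 3 + γ ζ ^ 7 + γ ζ ^ 9 := by rw [hr]; simp [map_add, map_pow]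
    rw [hγr, hγζ]
    rcases hγ with h | h | h | h <;> rw [h] <;> simp only [← pow_mul]
    · rw [show (1 : ZMod 20).val = 1 from rfl]; ring
    · rw [show (3 : ZMod 20).val = 3 from rfl]; norm_num
      rw [pow_eq_pow_mod h20 21, pow_eq_pow_mod h20 27]; norm_num; rw [hr]; ring
    · rw [show (7 : ZMod 20).val = 7 from rfl]; norm_num
      rw [pow_eq_pow_mod h20 21, pow_eq_pow_mod h20 49, pow_eq_pow_mod h20 63]; norm_num; rw [hr]; ring
    · rw [show (9 : ZMod 20).val = 9 from rfl]; norm_num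
      rw [pow_eq_pow_mod h20 27, pow_eq_pow_mod h20 63, pow_eq_pow_mod h20 81]; norm_num; rw [hr]; ring
  -- degrees
  have hK4 : Module.finrank K₁ K = 4 := by
    rw [finrank_eq_card_filter_of_primitive (N := 20) Φ Φ₁ h₁ hp₁, hW]; decide
  have hdegK : Module.finrank ℚ K = 8 := by
    rw [IsCyclotomicExtension.finrank (K := ℚ) (n := 20) K (Polynomial.cyclotomic.irreducible_rat (by norm_num))]
    decide
  have hdeg₁ : Module.finrank ℚ K₁ = 2 := by
    have htower := Module.finrank_mul_finrank ℚ K₁ K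
    rw [hK4, hdegK] at htower
    omega
  -- `K₁ = ℚ(r)`
  set M : IntermediateField ℚ K := IntermediateField.adjoin ℚ {r} with hM
  have hle : M ≤ K₁ := IntermediateField.adjoin_simple_le_iff.2 hrK
  set r' : M := ⟨r, IntermediateField.mem_adjoin_simple_self ℚ r⟩ with hr'
  set p : Polynomial M := Polynomial.X ^ 4 - Polynomial.C r' * Polynomial.X ^ 3 - Polynomial.C 3 * Polynomial.X ^ 2 +
    Polynomial.C r' * Polynomial.X + 1 with hp
  have hp4 : p.coeff 4 = 1 := by
    simp [hp, Polynomial.coeff_one, Polynomial.coeff_X_pow]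
  have hpdeg : p.degree ≤ 4 := by
    rw [hp]
    compute_degree!
  have haeval : Polynomial.aeval (zetaOf 20 K) p = 0 := by
    have hrval : algebraMap M K r' = r := rfl
    rw [← hζdef]
    simp only [hp, map_sub, map_add, map_mul, map_pow, Polynomial.aeval_X, Polynomial.aeval_C, map_one, hrval, hr,
      map_ofNat]
    linear_combination (-ζ ^ 2 + ζ ^ 4 + ζ ^ 8 + ζ ^ 10) * h10 + (1 - ζ ^ 2 - ζ ^ 4) * h5
  have hfinM : Module.finrank M K ≤ 4 := finrank_le_four_of_quartic M p hp4 hpdeg haeval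
  have hMK : M = K₁ := IntermediateField.eq_of_le_of_finrank_le' hle (by rw [hK4]; exact hfinM)
  exact ⟨hr2, hrK, hK4, hdeg₁, hMK.symm⟩

/-- **GGL §3.4, `d = 24`: «the CM field of the elliptic curve `Y_{24}` is ℚ(√−6)».**  For the lower-half type `Φ` of `K = ℚ(ζ_{24})` and
ANY primitive sub-pair `(K₁, Φ₁)`: the period `r = ζ + ζ⁵ + ζ⁷ + ζ¹¹` of the stabiliser `W = {1, 5, 7, 11}` satisfies `r² = −6`, lies in `K₁`,
`[K : K₁] = 4`, `[K₁ : ℚ] = 2`, and `K₁ = ℚ(r) = ℚ(√−6)`. [cite: GalleseGoodsonLombardo2024, §3.4 and Lemma 14 (`F_{24} = ℚ(√−6)`)]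
[cite: KoblitzRohrlich1978, §1 (p. 1184)] -/
theorem primitiveSubfield_twentyFour [IsCyclotomicExtension {24} ℚ K] (Φ : CMType K)
    (hΦ : ∀ σ : K →+* ℂ, σ ∈ Φ.1 ↔ 2 * (expOf 24 K σ).val < 24) {K₁ : IntermediateField ℚ K} (Φ₁ : CMType K₁)
    (h₁ : inducedCMType (algebraMap K₁ K) Φ₁ = Φ)
    (hp₁ : ∀ s t : K₁ →+* ℂ,
      (∀ τ : ℂ ≃+* ℂ, (τ : ℂ →+* ℂ).comp s ∈ Φ₁.1 ↔ (τ : ℂ →+* ℂ).comp t ∈ Φ₁.1) → s = t) :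
    (zetaOf 24 K + zetaOf 24 K ^ 5 + zetaOf 24 K ^ 7 + zetaOf 24 K ^ 11) ^ 2 = -6 ∧
    zetaOf 24 K + zetaOf 24 K ^ 5 + zetaOf 24 K ^ 7 + zetaOf 24 K ^ 11 ∈ K₁ ∧
    Module.finrank K₁ K = 4 ∧ Module.finrank ℚ K₁ = 2 ∧
    K₁ = IntermediateField.adjoin ℚ {zetaOf 24 K + zetaOf 24 K ^ 5 + zetaOf 24 K ^ 7 + zetaOf 24 K ^ 11} := by
  classical
  set ζ := zetaOf 24 K with hζdef
  have hζ : IsPrimitiveRoot ζ 24 := IsCyclotomicExtension.zeta_spec 24 ℚ K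
  have h24 : ζ ^ 24 = 1 := hζ.pow_eq_one
  have h12 : ζ ^ 12 = -1 := (hζ.pow (by norm_num) (show 24 = 12 * 2 by norm_num)).eq_neg_one_of_two_right
  have h3 : 1 + ζ ^ 8 + ζ ^ 16 = 0 := by
    have h := (hζ.pow (by norm_num) (show 24 = 8 * 3 by norm_num)).geom_sum_eq_zero (by norm_num : 1 < 3)
    simp only [Finset.sum_range_succ, Finset.sum_range_zero, ← pow_mul, zero_add] at h
    norm_num at h
    linear_combination h
  set r := ζ + ζ ^ 5 + ζ ^ 7 + ζ ^ 11 with hr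
  have hr2 : r ^ 2 = -6 := by
    rw [hr]
    linear_combination (-6 * ζ ^ 4 - ζ ^ 6 - 6 * ζ ^ 8 - 3 * ζ ^ 10 - 2 * ζ ^ 12 - 3 * ζ ^ 14 - ζ ^ 18) * h12
      + (6 + ζ ^ 2 + 6 * ζ ^ 4 + 3 * ζ ^ 6 + 2 * ζ ^ 8 + 3 * ζ ^ 10 + ζ ^ 14) * h3
  have hW : ((unitResidues 24).filter fun t =>
      ∀ c ∈ unitResidues 24, (c * t ∈ residueSet 24 Φ ↔ c ∈ residueSet 24 Φ)) = {1, 5, 7, 11} := by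
    rw [Finset.filter_congr fun t ht => forall_mem_residueSet_half_iff Φ hΦ ht, stabilizer_half_twentyFour]
  have hrK : r ∈ K₁ := by
    refine (mem_iff_forall_autResidue_mem_of_primitive (N := 24) Φ Φ₁ h₁ hp₁ r).2 fun γ hγ => ?_
    rw [hW] at hγ
    simp only [Finset.mem_insert, Finset.mem_singleton] at hγ
    have hγζ : γ ζ = ζ ^ (autResidue 24 K γ).val := autResidue_spec 24 γ
    have hγr : γ r = γ ζ + γ ζ ^ 5 + γ ζ ^ 7 + γ ζ ^ 11 := by rw [hr]; simp [map_add, map_pow]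
    rw [hγr, hγζ]
    rcases hγ with h | h | h | h <;> rw [h] <;> simp only [← pow_mul]
    · rw [show (1 : ZMod 24).val = 1 from rfl]; ring
    · rw [show (5 : ZMod 24).val = 5 from rfl]; norm_num
      rw [pow_eq_pow_mod h24 25, pow_eq_pow_mod h24 35, pow_eq_pow_mod h24 55]; norm_num; rw [hr]; ring
    · rw [show (7 : ZMod 24).val = 7 from rfl]; norm_num
      rw [pow_eq_pow_mod h24 35, pow_eq_pow_mod h24 49, pow_eq_pow_mod h24 77]; norm_num; rw [hr]; ring
    · rw [show (11 : ZMod 24).val = 11 from rfl]; norm_num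
      rw [pow_eq_pow_mod h24 55, pow_eq_pow_mod h24 77, pow_eq_pow_mod h24 121]; norm_num; rw [hr]; ring
  have hK4 : Module.finrank K₁ K = 4 := by
    rw [finrank_eq_card_filter_of_primitive (N := 24) Φ Φ₁ h₁ hp₁, hW]; decide
  have hdegK : Module.finrank ℚ K = 8 := by
    rw [IsCyclotomicExtension.finrank (K := ℚ) (n := 24) K (Polynomial.cyclotomic.irreducible_rat (by norm_num))]
    decide
  have hdeg₁ : Module.finrank ℚ K₁ = 2 := by
    have htower := Module.finrank_mul_finrank ℚ K₁ K
    rw [hK4, hdegK] at htower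
    omega
  set M : IntermediateField ℚ K := IntermediateField.adjoin ℚ {r} with hM
  have hle : M ≤ K₁ := IntermediateField.adjoin_simple_le_iff.2 hrK
  set r' : M := ⟨r, IntermediateField.mem_adjoin_simple_self ℚ r⟩ with hr'
  set p : Polynomial M := Polynomial.X ^ 4 - Polynomial.C r' * Polynomial.X ^ 3 - Polynomial.C 3 * Polynomial.X ^ 2 +
    Polynomial.C r' * Polynomial.X + 1 with hp
  have hp4 : p.coeff 4 = 1 := by
    simp [hp, Polynomial.coeff_one, Polynomial.coeff_X_pow]
  have hpdeg : p.degree ≤ 4 := by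
    rw [hp]
    compute_degree!
  have haeval : Polynomial.aeval (zetaOf 24 K) p = 0 := by
    have hrval : algebraMap M K r' = r := rfl
    rw [← hζdef]
    simp only [hp, map_sub, map_add, map_mul, map_pow, Polynomial.aeval_X, Polynomial.aeval_C, map_one, hrval, hr,
      map_ofNat]
    linear_combination (-ζ ^ 4 + 2 * ζ ^ 6 - ζ ^ 8 + ζ ^ 10) * h12 + (1 - 2 * ζ ^ 2 + ζ ^ 4 - ζ ^ 6) * h3
  have hfinM : Module.finrank M K ≤ 4 := finrank_le_four_of_quartic M p hp4 hpdeg haeval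
  have hMK : M = K₁ := IntermediateField.eq_of_le_of_finrank_le' hle (by rw [hK4]; exact hfinM)
  exact ⟨hr2, hrK, hK4, hdeg₁, hMK.symm⟩

/-- **GGL §3.4, `d = 60`: «the CM field of `Y_{60}` is the splitting field of `x⁴ + 15x² + 45`» (Lemma 14: `F_{60}` = the field
generated by a root of `x⁴ + 15x² + 45`, «a degree-4 normal subextension of ℚ(ζ_{60})»).**  For the lower-half type `Φ` of
`K = ℚ(ζ_{60})` and ANY primitive sub-pair `(K₁, Φ₁)`: the period `r = ζ + ζ¹¹ + ζ¹⁹ + ζ²⁹` of the stabiliser `W = {1, 11, 19, 29}`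
satisfies `r⁴ + 15r² + 45 = 0` (indeed `2r² + 15 = 3s`, `s² = 5` with the Gauss sum `s = ζ¹² − ζ²⁴ − ζ³⁶ + ζ⁴⁸ = √5`), lies in `K₁`,
`[K : K₁] = 4`, `[K₁ : ℚ] = 4`, and `K₁ = ℚ(r)` (`ζ` is a root of `X⁴ − rX³ + ((r² − 3)/3)X² + rX + 1 ∈ ℚ(r)[X]`).
[cite: GalleseGoodsonLombardo2024, §3.4 and Lemma 14 (`F_{60}`)] [cite: KoblitzRohrlich1978, §1 (p. 1184)] -/
theorem primitiveSubfield_sixty [IsCyclotomicExtension {60} ℚ K] (Φ : CMType K)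
    (hΦ : ∀ σ : K →+* ℂ, σ ∈ Φ.1 ↔ 2 * (expOf 60 K σ).val < 60) {K₁ : IntermediateField ℚ K} (Φ₁ : CMType K₁)
    (h₁ : inducedCMType (algebraMap K₁ K) Φ₁ = Φ)
    (hp₁ : ∀ s t : K₁ →+* ℂ,
      (∀ τ : ℂ ≃+* ℂ, (τ : ℂ →+* ℂ).comp s ∈ Φ₁.1 ↔ (τ : ℂ →+* ℂ).comp t ∈ Φ₁.1) → s = t) :
    (zetaOf 60 K + zetaOf 60 K ^ 11 + zetaOf 60 K ^ 19 + zetaOf 60 K ^ 29) ^ 4 +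
        15 * (zetaOf 60 K + zetaOf 60 K ^ 11 + zetaOf 60 K ^ 19 + zetaOf 60 K ^ 29) ^ 2 + 45 = 0 ∧
    (2 * (zetaOf 60 K + zetaOf 60 K ^ 11 + zetaOf 60 K ^ 19 + zetaOf 60 K ^ 29) ^ 2 + 15 =
        3 * (zetaOf 60 K ^ 12 - zetaOf 60 K ^ 24 - zetaOf 60 K ^ 36 + zetaOf 60 K ^ 48) ∧
      (zetaOf 60 K ^ 12 - zetaOf 60 K ^ 24 - zetaOf 60 K ^ 36 + zetaOf 60 K ^ 48) ^ 2 = 5) ∧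
    zetaOf 60 K + zetaOf 60 K ^ 11 + zetaOf 60 K ^ 19 + zetaOf 60 K ^ 29 ∈ K₁ ∧
    Module.finrank K₁ K = 4 ∧ Module.finrank ℚ K₁ = 4 ∧
    K₁ = IntermediateField.adjoin ℚ {zetaOf 60 K + zetaOf 60 K ^ 11 + zetaOf 60 K ^ 19 + zetaOf 60 K ^ 29} := by
  classical
  set ζ := zetaOf 60 K with hζdef
  have hζ : IsPrimitiveRoot ζ 60 := IsCyclotomicExtension.zeta_spec 60 ℚ K
  have h60 : ζ ^ 60 = 1 := hζ.pow_eq_one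
  have h30 : ζ ^ 30 = -1 := (hζ.pow (by norm_num) (show 60 = 30 * 2 by norm_num)).eq_neg_one_of_two_right
  have h5 : 1 + ζ ^ 12 + ζ ^ 24 + ζ ^ 36 + ζ ^ 48 = 0 := by
    have h := (hζ.pow (by norm_num) (show 60 = 12 * 5 by norm_num)).geom_sum_eq_zero (by norm_num : 1 < 5)
    simp only [Finset.sum_range_succ, Finset.sum_range_zero, ← pow_mul, zero_add] at h
    norm_num at h
    linear_combination h
  have h3 : 1 + ζ ^ 20 + ζ ^ 40 = 0 := by
    have h := (hζ.pow (by norm_num) (show 60 = 20 * 3 by norm_num)).geom_sum_eq_zero (by norm_num : 1 < 3)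
    simp only [Finset.sum_range_succ, Finset.sum_range_zero, ← pow_mul, zero_add] at h
    norm_num at h
    linear_combination h
  set r := ζ + ζ ^ 11 + ζ ^ 19 + ζ ^ 29 with hr
  set s := ζ ^ 12 - ζ ^ 24 - ζ ^ 36 + ζ ^ 48 with hs
  have hs5 : s ^ 2 = 5 := by
    rw [hs]
    linear_combination (-5 + 5 * ζ ^ 12 + ζ ^ 24 - 3 * ζ ^ 36 + ζ ^ 48) * h5
  have ha : 2 * r ^ 2 + 15 = 3 * s := by
    rw [hr, hs]
    linear_combination (8 + 3 * ζ ^ 6 - 5 * ζ ^ 8 + 9 * ζ ^ 10 - 5 * ζ ^ 12 + ζ ^ 14 + 6 * ζ ^ 16 - 6 * ζ ^ 18 + 4 * ζ ^ 22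
        - 4 * ζ ^ 24 + 3 * ζ ^ 26 - ζ ^ 28 - 2 * ζ ^ 30 + 2 * ζ ^ 32 - 7 * ζ ^ 40 + 5 * ζ ^ 42 - 5 * ζ ^ 44 + ζ ^ 46 - ζ ^ 48
        - 2 * ζ ^ 50 + 2 * ζ ^ 52) * h30
      + (7 * ζ ^ 2 - 5 * ζ ^ 4 + 5 * ζ ^ 6 - ζ ^ 8 - 6 * ζ ^ 10 + 7 * ζ ^ 12 - 7 * ζ ^ 14 + ζ ^ 16 - ζ ^ 18 - 2 * ζ ^ 20
        + 9 * ζ ^ 22 - 5 * ζ ^ 24 + 5 * ζ ^ 26 - ζ ^ 28 + ζ ^ 30 + 2 * ζ ^ 32 - 2 * ζ ^ 34) * h5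
      + (7 - 5 * ζ ^ 2 + 5 * ζ ^ 4 - 8 * ζ ^ 6 + 6 * ζ ^ 8 - 3 * ζ ^ 10 - ζ ^ 12 - ζ ^ 14 - 2 * ζ ^ 16 + 2 * ζ ^ 18) * h3
  have hr4 : r ^ 4 + 15 * r ^ 2 + 45 = 0 := by
    linear_combination ((2 * r ^ 2 + 15 + 3 * s) / 4) * ha + (9 / 4 : K) * hs5
  have hW : ((unitResidues 60).filter fun t =>
      ∀ c ∈ unitResidues 60, (c * t ∈ residueSet 60 Φ ↔ c ∈ residueSet 60 Φ)) = {1, 11, 19, 29} := by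
    rw [Finset.filter_congr fun t ht => forall_mem_residueSet_half_iff Φ hΦ ht, stabilizer_half_sixty]
  have hrK : r ∈ K₁ := by
    refine (mem_iff_forall_autResidue_mem_of_primitive (N := 60) Φ Φ₁ h₁ hp₁ r).2 fun γ hγ => ?_
    rw [hW] at hγ
    simp only [Finset.mem_insert, Finset.mem_singleton] at hγ
    have hγζ : γ ζ = ζ ^ (autResidue 60 K γ).val := autResidue_spec 60 γ
    have hγr : γ r = γ ζ + γ ζ ^ 11 + γ ζ ^ 19 + γ ζ ^ 29 := by rw [hr]; simp [map_add, map_pow]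
    rw [hγr, hγζ]
    rcases hγ with h | h | h | h <;> rw [h] <;> simp only [← pow_mul]
    · rw [show (1 : ZMod 60).val = 1 from rfl]; ring
    · rw [show (11 : ZMod 60).val = 11 from rfl]; norm_num
      rw [pow_eq_pow_mod h60 121, pow_eq_pow_mod h60 209, pow_eq_pow_mod h60 319]; norm_num; rw [hr]; ring
    · rw [show (19 : ZMod 60).val = 19 from rfl]; norm_num
      rw [pow_eq_pow_mod h60 209, pow_eq_pow_mod h60 361, pow_eq_pow_mod h60 551]; norm_num; rw [hr]; ring
    · rw [show (29 : ZMod 60).val = 29 from rfl]; norm_num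
      rw [pow_eq_pow_mod h60 319, pow_eq_pow_mod h60 551, pow_eq_pow_mod h60 841]; norm_num; rw [hr]; ring
  have hK4 : Module.finrank K₁ K = 4 := by
    rw [finrank_eq_card_filter_of_primitive (N := 60) Φ Φ₁ h₁ hp₁, hW]; decide
  have hdegK : Module.finrank ℚ K = 16 := by
    rw [IsCyclotomicExtension.finrank (K := ℚ) (n := 60) K (Polynomial.cyclotomic.irreducible_rat (by norm_num))]
    decide
  have hdeg₁ : Module.finrank ℚ K₁ = 4 := by
    have htower := Module.finrank_mul_finrank ℚ K₁ K
    rw [hK4, hdegK] at htower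
    omega
  set M : IntermediateField ℚ K := IntermediateField.adjoin ℚ {r} with hM
  have hle : M ≤ K₁ := IntermediateField.adjoin_simple_le_iff.2 hrK
  set r' : M := ⟨r, IntermediateField.mem_adjoin_simple_self ℚ r⟩ with hr'
  set p : Polynomial M := Polynomial.X ^ 4 - Polynomial.C r' * Polynomial.X ^ 3 +
    Polynomial.C ((r' ^ 2 - 3) / 3) * Polynomial.X ^ 2 + Polynomial.C r' * Polynomial.X + 1 with hp
  have hp4 : p.coeff 4 = 1 := by
    simp [hp, Polynomial.coeff_one, Polynomial.coeff_X_pow]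
  have hpdeg : p.degree ≤ 4 := by
    rw [hp]
    compute_degree!
  have haeval : Polynomial.aeval (zetaOf 60 K) p = 0 := by
    have hrval : algebraMap M K r' = r := rfl
    have heval : algebraMap M K ((r' ^ 2 - 3) / 3) = (r ^ 2 - 3) / 3 := by
      rw [map_div₀, map_sub, map_pow, hrval, map_ofNat]
    rw [← hζdef]
    simp only [hp, map_sub, map_add, map_mul, map_pow, Polynomial.aeval_X, Polynomial.aeval_C, map_one, hrval, heval]
    have ha' := ha
    rw [hr, hs] at ha'
    rw [hr]
    linear_combination (1 - ζ ^ 2 - (1/2 : K) * ζ ^ 8 + (3/2 : K) * ζ ^ 10 - (3/2 : K) * ζ ^ 12 + (3/2 : K) * ζ ^ 14 - (1/2 : K) * ζ ^ 16 - ζ ^ 18 + 2 * ζ ^ 20 - ζ ^ 24 + ζ ^ 26 - (1/2 : K) * ζ ^ 28 + (1/2 : K) * ζ ^ 30 + (3/2 : K) * ζ ^ 42 - (3/2 : K) * ζ ^ 44 + (3/2 : K) * ζ ^ 46 - (1/2 : K) * ζ ^ 48 + (1/2 : K) * ζ ^ 50) * h30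
      + (-(3/2 : K) * ζ ^ 4 + (3/2 : K) * ζ ^ 6 - (3/2 : K) * ζ ^ 8 + (1/2 : K) * ζ ^ 10 + ζ ^ 12 - (3/2 : K) * ζ ^ 14 + (3/2 : K) * ζ ^ 16 - (1/2 : K) * ζ ^ 18 + (1/2 : K) * ζ ^ 20 - (3/2 : K) * ζ ^ 24 + (3/2 : K) * ζ ^ 26 - (3/2 : K) * ζ ^ 28 + (1/2 : K) * ζ ^ 30 - (1/2 : K) * ζ ^ 32) * h5
      + (-(3/2 : K) * ζ ^ 2 + (3/2 : K) * ζ ^ 4 - (3/2 : K) * ζ ^ 6 + 2 * ζ ^ 8 - 2 * ζ ^ 10 + (3/2 : K) * ζ ^ 12 - (1/2 : K) * ζ ^ 14 + (1/2 : K) * ζ ^ 16) * h3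
      + (ζ ^ 2 / 6) * ha'
  have hfinM : Module.finrank M K ≤ 4 := finrank_le_four_of_quartic M p hp4 hpdeg haeval
  have hMK : M = K₁ := IntermediateField.eq_of_le_of_finrank_le' hle (by rw [hK4]; exact hfinM)
  exact ⟨hr4, ⟨ha, hs5⟩, hrK, hK4, hdeg₁, hMK.symm⟩

end ExceptionalFields


end HyperellipticJacobian

end Literature.AlgebraicGeometry.ComplexMultiplication
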